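import Literature.NumberTheory.Transcendental.CijsouwWaldschmidt1977Params
import Literature.NumberTheory.Transcendental.CijsouwWaldschmidt1977Steps
import HarnessLib

/-!
# Cijsouw–Waldschmidt 1977, Proposition 1 over `ℚ` (`p = 2`): sizes, assembly, and the bound `hW₃`

The proof of Proposition 1 of Cijsouw–Waldschmidt over `K = ℚ` with `p = 2`, `β₀ = 0`
(`Setup.Hyp.main`): Part I bounds every quantity of Steps 1–3 by powers of a common
`𝔅 = exp(β 𝔘)`, `𝔘 = ν^{2m+3} U`; Part II runs Step 1 (`siegel_step` with `Amax = 𝔅⁶`), Step 2 at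
every level `J < J₀` (`half_vanish` with these bounds, then `descent_algebra`) and Step 3
(`endgame`) under the negation `|Λ₀| ≤ exp(−ν^{2m+5} U)` of the conclusion; Part III translates the
result (`cw77_prop1_rat_hW₃`) into the symmetric shape `hW₃` of
`Literature.Barriers.ABC.BakerMethodBounds_of_yu_kummerArchBound₃`: a concrete admissible
`ν(n) = (10⁶ 4^{n+2} (n+2))²`, the constant `archCw`, the converse of the Kummer computation
(`not_isSquare_prod_of_finrank_eq`: degree `2^{n+1}` forces independent square classes), the
elimination of a logarithm with non-zero coefficient, and the comparison of
`ν^{2n+7} Ω log Ω (log B + log Ω)` with `C(n+1) · V₀⋯Vₙ · (W + log 2Vₙ) · log 2Vₙ`.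

This is the archimedean half of the Stewart–Yu bound `log c ≤ κ rad^{1/3} (log rad)³`
(`Literature.Barriers.ABC.BakerMethodBounds`) by Baker's method in its 1977 form: auxiliary
functions with Baker's `Δ`-polynomials, a `2`-descent (Kummer condition) and ONE Schwarz lemma per
step (Cijsouw–Waldschmidt's Lemma 2, here a Hermite interpolation bound), no zero estimate.

## References
* P. L. Cijsouw, M. Waldschmidt, *Linear forms and simultaneous approximations*, Compositio Math.
  34 (1977), 173–197, Proposition 1 and §4.
* A. Baker, *Transcendental Number Theory*, Cambridge University Press, 1975, Ch. 3.
-/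

/-!
# Part I: the sizes of all the quantities of the proof

With the parameters of `CijsouwWaldschmidt1977Params` and the link `Hyp` between the data and the
parameters (heights `≤ exp Eᵢ`, coefficients `≤ B`), every quantity entering Steps 1–3 is bounded by
a power of the common bound `𝔅 = exp(β 𝔘)`, `𝔘 = ν^{2m+3} U`: the number of unknowns, the cleared
coefficients of Step 1 (`Amax = 𝔅⁶`), the `Δ`-factors `Qw` on the discs (Cijsouw–Waldschmidt (8):
the main term is `ν(x, R)^{T} ≤ exp((40 + (18m+28) log ν) 𝔘)`, Baker's Lemma 1), the factors
`A(u,τ')`, the exponents `ψ`, the half-point coefficients `rHalf` and their denominators `Dhalf`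
(`𝔅³`), the height product of Lemma 10, and the final numerical inequality
`3 𝔅¹⁵ e^{−ν𝔘/128} (𝔅¹⁷)^{4^{m+1}} < 1` from the largeness of `ν`.

## References
* P. L. Cijsouw, M. Waldschmidt, *Linear forms and simultaneous approximations*, Compositio Math.
  34 (1977), 173–197, §4.
* A. Baker, *Transcendental Number Theory*, Cambridge University Press, 1975, Ch. 3.
-/

noncomputable section

open Complex Finset Polynomial
open Literature.NumberTheory.Transcendental.Baker1975
open Literature.NumberTheory.Transcendental.Baker1975.Ch3

namespace Literature.NumberTheory.Transcendental.CW77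

/-- `|log q| ≤ log H(q)` for a positive rational `q`. [folklore] -/
theorem abs_log_le_log_hgt (q : ℚ) (hq : 0 < q) : |Real.log (q : ℝ)| ≤ Real.log (hgt q) := by
  have hq' : (0 : ℝ) < q := by exact_mod_cast hq
  have h1 := one_le_hgt q
  rcases le_or_gt 1 (q : ℝ) with h | h
  · rw [abs_of_nonneg (Real.log_nonneg h)]
    exact Real.log_le_log hq' ((le_abs_self _).trans (abs_le_hgt q))
  · rw [abs_of_neg (Real.log_neg hq' h), ← Real.log_inv]
    refine Real.log_le_log (inv_pos.mpr hq') ?_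
    have hnum : (1 : ℝ) ≤ q.num := by exact_mod_cast Rat.num_pos.mpr hq
    have hden : (0 : ℝ) < q.den := by exact_mod_cast q.pos
    have hq_eq : (q : ℝ) = q.num / q.den := by rw [← Rat.num_div_den q]; push_cast; simp [Rat.num_div_den]
    calc (q : ℝ)⁻¹ = q.den / q.num := by rw [hq_eq, inv_div]
      _ ≤ q.den / 1 := div_le_div_of_nonneg_left hden.le one_pos hnum
      _ = q.den := div_one _
      _ ≤ hgt q := den_le_hgt q

/-- `0 < H(q)`. [folklore] -/
theorem hgt_pos (q : ℚ) : 0 < hgt q := lt_of_lt_of_le one_pos (one_le_hgt q)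

/-- `q ≤ H(q)`. [folklore] -/
theorem self_le_hgt (q : ℚ) : (q : ℝ) ≤ hgt q := (le_abs_self _).trans (abs_le_hgt q)

namespace Setup

variable (S : Setup)

/-- **The link between the data `S` and the parameters `P`**: the heights of all the rationals
are bounded by `exp Eᵢ` and the coefficients by `B`. [cite: CijsouwWaldschmidt1977, Theorem 1] -/
structure Hyp (P : Par S.d) : Prop where
  /-- `log H(allᵢ) ≤ Eᵢ` -/
  hH : ∀ i, Real.log (hgt (S.all i)) ≤ P.E i
  /-- `|bⱼ| ≤ B` -/
  hb : ∀ j, |(S.b j : ℝ)| ≤ P.B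
  /-- `|b_θ| ≤ B` -/
  hbθ : |(S.bθ : ℝ)| ≤ P.B

variable {S}
variable {P : Par S.d} (hy : S.Hyp P)
include hy

/-- `H(allᵢ) ≤ exp Eᵢ`. [folklore] -/
theorem Hyp.hgt_le (i : Fin (S.d + 1)) : hgt (S.all i) ≤ Real.exp (P.E i) := by
  have := hy.hH i
  rwa [Real.log_le_iff_le_exp (hgt_pos _)] at this

/-- `|log allᵢ| ≤ Eᵢ`. [folklore] -/
theorem Hyp.abs_log_all_le (i : Fin (S.d + 1)) : |Real.log (S.all i : ℝ)| ≤ P.E i :=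
  (abs_log_le_log_hgt _ (S.all_pos i)).trans (hy.hH i)

/-- `|lⱼ| ≤ E_j`. [folklore] -/
theorem Hyp.abs_l_le (j : Fin S.d) : |S.l j| ≤ P.E (Fin.castSucc j) := by
  have := hy.abs_log_all_le (Fin.castSucc j)
  unfold all at this
  rwa [Fin.snoc_castSucc] at this

/-- `|l_θ| ≤ E_last`. [folklore] -/
theorem Hyp.abs_lθ_le : |S.lθ| ≤ P.E (Fin.last S.d) := by
  have := hy.abs_log_all_le (Fin.last S.d)
  unfold all at this
  rwa [Fin.snoc_last] at this

/-- `1 + ∑ |lⱼ| ≤ 1 + (d+1) Ω`. [folklore] -/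
theorem Hyp.one_add_sum_abs_l_le : 1 + ∑ j, |S.l j| ≤ 1 + (S.d + 1) * P.Ω := by
  have h1 : ∑ j, |S.l j| ≤ ∑ j : Fin S.d, P.E (Fin.castSucc j) := sum_le_sum fun j _ => hy.abs_l_le j
  have h2 : ∑ j : Fin S.d, P.E (Fin.castSucc j) ≤ ∑ i, P.E i := by
    rw [Fin.sum_univ_castSucc]
    linarith [P.E_pos (Fin.last S.d)]
  linarith [P.sum_E_le]

/-- `|βⱼ| ≤ B`. [folklore] -/
theorem Hyp.abs_β_le (j : Fin S.d) : |(S.β j : ℝ)| ≤ P.B := by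
  unfold β
  push_cast
  rw [abs_div, abs_neg]
  have hbθ : (1 : ℝ) ≤ |(S.bθ : ℝ)| := by
    have h := Int.one_le_abs S.bθ_ne
    exact_mod_cast h
  calc |(S.b j : ℝ)| / |(S.bθ : ℝ)| ≤ |(S.b j : ℝ)| / 1 :=
        div_le_div_of_nonneg_left (abs_nonneg _) one_pos hbθ
    _ = |(S.b j : ℝ)| := div_one _
    _ ≤ P.B := hy.hb j

/-- `|γⱼ(u)| ≤ Lⱼ + L_θ B` on the box of level `J`. [folklore] -/
theorem Hyp.abs_γ_le {R Lb : ℕ} {L : Fin S.d → ℕ} {Lθ J : ℕ} {u : Idx S.d R Lb}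
    (hu : u ∈ S.box (h := R) (Lb := Lb) L Lθ J) (j : Fin S.d) :
    |(S.γ u j : ℝ)| ≤ L j + Lθ * P.B := by
  rw [S.mem_box] at hu
  unfold γ
  push_cast
  have h1 : (u.2.1 j : ℝ) ≤ L j := by exact_mod_cast (hu.1 j).trans (Nat.div_le_self _ _)
  have h2 : (u.2.2 : ℝ) ≤ Lθ := by exact_mod_cast hu.2.trans (Nat.div_le_self _ _)
  have hB : 0 ≤ P.B := le_trans (Real.exp_pos 1).le P.hB
  calc |(u.2.1 j : ℝ) + (u.2.2 : ℝ) * (S.β j : ℝ)| ≤ |(u.2.1 j : ℝ)| + |(u.2.2 : ℝ) * (S.β j : ℝ)| :=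
        abs_add_le _ _
    _ = (u.2.1 j : ℝ) + (u.2.2 : ℝ) * |(S.β j : ℝ)| := by
        rw [abs_mul, Nat.abs_cast, Nat.abs_cast]
    _ ≤ L j + Lθ * P.B := add_le_add h1 (mul_le_mul h2 (hy.abs_β_le j) (abs_nonneg _) (by positivity))

/-- The uniform bound `Γ = ν^{2d+2} X B` for the `γⱼ`. [folklore] -/
theorem Hyp.abs_γ_le' {J : ℕ} {u : Idx S.d P.R P.Lb}
    (hu : u ∈ S.box (h := P.R) (Lb := P.Lb) P.L P.Lθ J) (j : Fin S.d) :
    |(S.γ u j : ℝ)| ≤ (P.ν : ℝ) ^ (2 * S.d + 2) * P.X * P.B := by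
  refine (hy.abs_γ_le hu j).trans ?_
  have h1 := P.Lf_le' (Fin.castSucc j)
  have h2 := P.Lf_le' (Fin.last S.d)
  have hB : 1 ≤ P.B := le_trans (by linarith [Real.exp_one_gt_two]) P.hB
  unfold Par.L Par.Lθ
  have h0 : (0 : ℝ) ≤ (P.ν : ℝ) ^ (2 * S.d + 2) * P.X / 2 := by have := P.X_pos; positivity
  nlinarith

omit hy in
/-- `log Γ ≤ (2d+2) log ν + 2 log Ω + W₀`. [folklore] -/
theorem log_Γ_le (P : Par S.d) : Real.log ((P.ν : ℝ) ^ (2 * S.d + 2) * P.X * P.B) ≤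
    (2 * S.d + 2) * Real.log P.ν + 2 * P.lΩ + P.W₀ := by
  have hB : 0 < P.B := lt_of_lt_of_le (Real.exp_pos 1) P.hB
  rw [Real.log_mul (by have := P.nu_pos; have := P.X_pos; positivity) hB.ne',
    Real.log_mul (by have := P.nu_pos; positivity) P.X_pos.ne', Real.log_pow]
  push_cast
  linarith [P.log_X_le, P.logB_le]

omit hy in
/-- `Γ ≥ 1`. [folklore] -/
theorem one_le_Γ (P : Par S.d) : (1 : ℝ) ≤ (P.ν : ℝ) ^ (2 * S.d + 2) * P.X * P.B := by
  have hB : 1 ≤ P.B := le_trans (by linarith [Real.exp_one_gt_two]) P.hB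
  have hν1 := P.one_le_nu_pow (2 * S.d + 2); have hX := P.two_le_X
  exact one_le_mul_of_one_le_of_one_le (one_le_mul_of_one_le_of_one_le hν1 (by linarith)) hB

omit hy in
/-- **`T · (a log ν + b log Ω + c W₀) ≤ 𝔘`** for moderate `a, b, c`: the lower-order terms.
[folklore] -/
theorem T_lin_le (P : Par S.d) {a b c : ℝ} (ha : 0 ≤ a) (hb : 0 ≤ b) (hc : 0 ≤ c)
    (ha' : a ≤ 100 * (S.d + 2)) (hb' : b ≤ 100) (hc' : c ≤ 100) :
    (P.T : ℝ) * (a * Real.log P.ν + b * P.lΩ + c * P.W₀) ≤ P.Uν := by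
  have hν := P.nu_ge; have hT := P.T_pos; have hl := P.log_nu_nonneg
  have h1 : (P.T : ℝ) * (a * Real.log P.ν) ≤ P.Uν / 20 := by
    have hk := P.klog_le (k := a) ha'
    have : a * Real.log P.ν ≤ P.ν / 10 := by nlinarith
    have := mul_le_mul_of_nonneg_left this hT.le
    have := P.T_le'
    nlinarith
  have hU := P.Uν_pos
  have h2 : (P.T : ℝ) * (b * P.lΩ) ≤ P.Uν / 100 := by
    have h4 := P.TlΩ_le; have := P.lΩ_pos
    have h5 : (P.T : ℝ) * (b * P.lΩ) * P.ν ≤ 100 * P.Uν := by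
      calc (P.T : ℝ) * (b * P.lΩ) * P.ν = b * (P.ν * (P.T * P.lΩ)) := by ring
        _ ≤ b * P.Uν := mul_le_mul_of_nonneg_left h4 hb
        _ ≤ 100 * P.Uν := mul_le_mul_of_nonneg_right hb' hU.le
    have h0 : 0 ≤ (P.T : ℝ) * (b * P.lΩ) := by positivity
    have h6 : (P.T : ℝ) * (b * P.lΩ) * 1000000 ≤ (P.T : ℝ) * (b * P.lΩ) * P.ν := mul_le_mul_of_nonneg_left hν h0
    linarith
  have h3 : (P.T : ℝ) * (c * P.W₀) ≤ P.Uν / 100 := by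
    have h4 := P.TW₀_le; have := P.W₀_pos
    have h5 : (P.T : ℝ) * (c * P.W₀) * P.ν ≤ 100 * P.Uν := by
      calc (P.T : ℝ) * (c * P.W₀) * P.ν = c * (P.ν * (P.T * P.W₀)) := by ring
        _ ≤ c * P.Uν := mul_le_mul_of_nonneg_left h4 hc
        _ ≤ 100 * P.Uν := mul_le_mul_of_nonneg_right hc' hU.le
    have h0 : 0 ≤ (P.T : ℝ) * (c * P.W₀) := by positivity
    have h6 : (P.T : ℝ) * (c * P.W₀) * 1000000 ≤ (P.T : ℝ) * (c * P.W₀) * P.ν := mul_le_mul_of_nonneg_left hν h0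
    linarith
  linarith

omit hy in
/-- **`R L_b · (a log ν + b log Ω + c) ≤ 𝔘`** for moderate `a, b, c`. [folklore] -/
theorem RLb_lin_le (P : Par S.d) {a b c : ℝ} (ha : 0 ≤ a) (hb : 0 ≤ b) (hc : 0 ≤ c)
    (ha' : a ≤ 100 * (S.d + 2)) (hb' : b ≤ 100) (hc' : c ≤ 100) :
    ((P.R : ℝ) * P.Lb) * (a * Real.log P.ν + b * P.lΩ + c) ≤ P.Uν := by
  have hν := P.nu_ge; have hl := P.log_nu_nonneg; have hU := P.Uν_pos
  have hRLb : 0 ≤ (P.R : ℝ) * P.Lb := by positivity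
  have h0 := P.RLb_le'
  have h1 : ((P.R : ℝ) * P.Lb) * (a * Real.log P.ν) ≤ P.Uν / 2 := by
    have hk := P.klog_le (k := a) ha'
    have : a * Real.log P.ν ≤ P.ν / 10 := by nlinarith
    have := mul_le_mul_of_nonneg_left this hRLb
    nlinarith
  -- `R L_b log Ω ≤ 3 ν^{2d+4} X W₀ + R log Ω ≤ 3 𝔘/ν + ν W₀ + log Ω`
  have e2 : (P.ν : ℝ) * ((P.ν : ℝ) ^ (2 * S.d + 4) * P.X * P.W₀) = P.Uν := by unfold Par.Uν Par.U; ring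
  have hνW : (P.ν : ℝ) * (P.ν * P.W₀ + P.lΩ) ≤ P.Uν := by
    have := P.lΩ_le_W₀; have hW := P.W₀_pos; have hX := P.two_le_X
    have hp : (P.ν : ℝ) ^ 2 ≤ (P.ν : ℝ) ^ (2 * S.d + 5) := P.nu_pow_le_pow (by omega)
    have hν1 := P.one_le_nu
    have h7a : P.lΩ ≤ P.ν * P.W₀ := le_trans this (le_mul_of_one_le_left hW.le hν1)
    have h7b : (P.ν : ℝ) * P.lΩ ≤ (P.ν : ℝ) ^ 2 * P.W₀ := by
      have := mul_le_mul_of_nonneg_left h7a P.nu_pos.le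
      calc (P.ν : ℝ) * P.lΩ ≤ P.ν * (P.ν * P.W₀) := this
        _ = (P.ν : ℝ) ^ 2 * P.W₀ := by ring
    have h7 : (P.ν : ℝ) * (P.ν * P.W₀ + P.lΩ) ≤ 2 * (P.ν : ℝ) ^ 2 * P.W₀ := by
      calc (P.ν : ℝ) * (P.ν * P.W₀ + P.lΩ) = (P.ν : ℝ) ^ 2 * P.W₀ + P.ν * P.lΩ := by ring
        _ ≤ (P.ν : ℝ) ^ 2 * P.W₀ + (P.ν : ℝ) ^ 2 * P.W₀ := add_le_add le_rfl h7b
        _ = 2 * (P.ν : ℝ) ^ 2 * P.W₀ := by ring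
    have h8 : 2 * (P.ν : ℝ) ^ 2 * P.W₀ ≤ (P.ν : ℝ) ^ (2 * S.d + 5) * (P.X * P.W₀) := by
      calc 2 * (P.ν : ℝ) ^ 2 * P.W₀ = (P.ν : ℝ) ^ 2 * (2 * P.W₀) := by ring
        _ ≤ (P.ν : ℝ) ^ (2 * S.d + 5) * (P.X * P.W₀) :=
            mul_le_mul hp (mul_le_mul_of_nonneg_right hX hW.le) (by positivity) (by positivity)
    unfold Par.Uν Par.U; linarith
  have h2 : ((P.R : ℝ) * P.Lb) * P.lΩ ≤ 4 * P.Uν / P.ν := by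
    have hRLb' := P.RLb_le
    have hRl := P.RlΩ_le
    have hl1 := P.lΩ_pos
    have eX : P.X = P.Ω * P.lΩ := rfl
    have hA : ((P.R : ℝ) * P.Lb) * P.lΩ ≤ 3 * ((P.ν : ℝ) ^ (2 * S.d + 4) * P.X * P.W₀) + (P.ν * P.W₀ + P.lΩ) := by
      calc ((P.R : ℝ) * P.Lb) * P.lΩ ≤ (3 * (P.ν : ℝ) ^ (2 * S.d + 4) * P.Ω * P.W₀ + P.R) * P.lΩ :=
            mul_le_mul_of_nonneg_right hRLb' hl1.le
        _ = 3 * ((P.ν : ℝ) ^ (2 * S.d + 4) * (P.Ω * P.lΩ) * P.W₀) + P.R * P.lΩ := by ring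
        _ ≤ 3 * ((P.ν : ℝ) ^ (2 * S.d + 4) * P.X * P.W₀) + (P.ν * P.W₀ + P.lΩ) := by rw [eX]; linarith
    rw [le_div_iff₀ P.nu_pos]
    calc ((P.R : ℝ) * P.Lb) * P.lΩ * P.ν ≤ (3 * ((P.ν : ℝ) ^ (2 * S.d + 4) * P.X * P.W₀) + (P.ν * P.W₀ + P.lΩ)) * P.ν :=
          mul_le_mul_of_nonneg_right hA P.nu_pos.le
      _ = 3 * (P.ν * ((P.ν : ℝ) ^ (2 * S.d + 4) * P.X * P.W₀)) + P.ν * (P.ν * P.W₀ + P.lΩ) := by ring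
      _ ≤ 3 * P.Uν + P.Uν := by rw [e2]; exact add_le_add le_rfl hνW
      _ = 4 * P.Uν := by ring
  have h2' : ((P.R : ℝ) * P.Lb) * (b * P.lΩ) ≤ P.Uν / 4 := by
    have h4 : ((P.R : ℝ) * P.Lb) * (b * P.lΩ) ≤ b * (4 * P.Uν / P.ν) := by
      calc ((P.R : ℝ) * P.Lb) * (b * P.lΩ) = b * (((P.R : ℝ) * P.Lb) * P.lΩ) := by ring
        _ ≤ b * (4 * P.Uν / P.ν) := mul_le_mul_of_nonneg_left h2 hb
    have h5 : b * (4 * P.Uν / P.ν) ≤ 100 * (4 * P.Uν / P.ν) :=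
      mul_le_mul_of_nonneg_right hb' (by have := P.nu_pos; positivity)
    have h6 : 100 * (4 * P.Uν / P.ν) ≤ P.Uν / 4 := by
      rw [mul_div_assoc', div_le_iff₀ P.nu_pos]; nlinarith
    linarith
  have h3 : ((P.R : ℝ) * P.Lb) * c ≤ P.Uν / 4 := by
    have h4 : ((P.R : ℝ) * P.Lb) * c * P.ν ≤ 400 * P.Uν := by
      calc ((P.R : ℝ) * P.Lb) * c * P.ν = c * (P.ν * (P.R * P.Lb)) := by ring
        _ ≤ c * (4 * P.Uν) := mul_le_mul_of_nonneg_left h0 hc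
        _ ≤ 100 * (4 * P.Uν) := mul_le_mul_of_nonneg_right hc' (by linarith)
        _ = 400 * P.Uν := by ring
    have h00 : 0 ≤ ((P.R : ℝ) * P.Lb) * c := by positivity
    have h5 : ((P.R : ℝ) * P.Lb) * c * 1000000 ≤ ((P.R : ℝ) * P.Lb) * c * P.ν := mul_le_mul_of_nonneg_left hν h00
    linarith
  linarith

/-! ### The factors `≤ 𝔅` -/

/-- **`|qA(u, τ')| ≤ 𝔅`** on the box, `|τ'| ≤ T`. [cite: CijsouwWaldschmidt1977, §4 (9)] -/
theorem Hyp.abs_qA_le {J : ℕ} {u : Idx S.d P.R P.Lb} (hu : u ∈ S.box (h := P.R) (Lb := P.Lb) P.L P.Lθ J)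
    {τ' : Fin S.d → ℕ} (hτ : ∑ j, τ' j ≤ P.T) : |(S.qA u τ' : ℝ)| ≤ P.𝔅 := by
  set Γ := (P.ν : ℝ) ^ (2 * S.d + 2) * P.X * P.B with hΓ
  have hΓ1 : 1 ≤ Γ := one_le_Γ P
  have h1 : |(S.qA u τ' : ℝ)| ≤ Γ ^ P.T := by
    unfold qA; push_cast
    rw [abs_prod]
    calc ∏ j, |(S.γ u j : ℝ) ^ τ' j| = ∏ j, |(S.γ u j : ℝ)| ^ τ' j := prod_congr rfl fun j _ => abs_pow _ _
      _ ≤ ∏ j, Γ ^ τ' j := prod_le_prod (fun j _ => by positivity)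
          fun j _ => pow_le_pow_left₀ (abs_nonneg _) (hy.abs_γ_le' hu j) _
      _ = Γ ^ ∑ j, τ' j := (prod_pow_eq_pow_sum _ _ _)
      _ ≤ Γ ^ P.T := pow_le_pow_right₀ hΓ1 hτ
  refine h1.trans (P.le_𝔅_of_log_le ?_)
  rw [Real.log_pow]
  calc (P.T : ℝ) * Real.log Γ ≤ P.T * ((2 * S.d + 2) * Real.log P.ν + 2 * P.lΩ + 1 * P.W₀) := by
        refine mul_le_mul_of_nonneg_left ?_ P.T_pos.le
        have := log_Γ_le P; rw [hΓ]; linarith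
    _ ≤ P.Uν := T_lin_le P (by positivity) (by norm_num) (by norm_num)
        (by have := Nat.cast_nonneg (α := ℝ) S.d; linarith) (by norm_num) (by norm_num)
    _ ≤ P.β * P.Uν := by linarith [P.Uν_le_βU, P.Uν_pos]

/-- `‖A(u, τ')‖ ≤ 𝔅` likewise. [folklore] -/
theorem Hyp.norm_A_le {J : ℕ} {u : Idx S.d P.R P.Lb} (hu : u ∈ S.box (h := P.R) (Lb := P.Lb) P.L P.Lθ J)
    {τ' : Fin S.d → ℕ} (hτ : ∑ j, τ' j ≤ P.T) : ‖S.A u τ'‖ ≤ P.𝔅 := by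
  rw [S.A_eq]
  have : ‖((S.qA u τ' : ℚ) : ℂ)‖ = |(S.qA u τ' : ℝ)| := by
    rw [← Complex.ofReal_ratCast, Complex.norm_real, Real.norm_eq_abs]
  rw [this]; exact hy.abs_qA_le hu hτ

/-- **`|b_θ|^k ≤ 𝔅`** for `k ≤ T`. [folklore] -/
theorem Hyp.natAbs_bθ_pow_le {k : ℕ} (hk : k ≤ P.T) : ((S.bθ.natAbs ^ k : ℕ) : ℝ) ≤ P.𝔅 := by
  have hB : 1 ≤ P.B := le_trans (by linarith [Real.exp_one_gt_two]) P.hB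
  have hB0 : 0 < P.B := by linarith
  have h1 : ((S.bθ.natAbs ^ k : ℕ) : ℝ) ≤ P.B ^ P.T := by
    push_cast
    rw [Nat.cast_natAbs, Int.cast_abs]
    exact (pow_le_pow_left₀ (abs_nonneg _) hy.hbθ k).trans (pow_le_pow_right₀ hB hk)
  refine h1.trans (P.le_𝔅_of_log_le ?_)
  rw [Real.log_pow]
  calc (P.T : ℝ) * Real.log P.B ≤ P.T * (0 * Real.log P.ν + 0 * P.lΩ + 1 * P.W₀) := by
        refine mul_le_mul_of_nonneg_left ?_ P.T_pos.le; linarith [P.logB_le]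
    _ ≤ P.Uν := T_lin_le P le_rfl le_rfl (by norm_num) (by positivity) (by norm_num) (by norm_num)
    _ ≤ P.β * P.Uν := by linarith [P.Uν_le_βU, P.Uν_pos]

/-- `H(allᵢ)^e ≤ exp(e Eᵢ)`. [folklore] -/
theorem Hyp.hgt_pow_le (i : Fin (S.d + 1)) (e : ℕ) : hgt (S.all i) ^ e ≤ Real.exp (e * P.E i) := by
  rw [Real.exp_nat_mul]
  exact pow_le_pow_left₀ (hgt_pos _).le (hy.hgt_le i) e

omit hy in
/-- `exp(∑ eᵢ Eᵢ) ≤ 𝔅` when `eᵢ ≤ 2 Lᵢ S₀`. [folklore] -/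
theorem exp_sum_le (P : Par S.d) {e : Fin (S.d + 1) → ℕ} (he : ∀ i, e i ≤ 2 * P.Lf i * P.S₀) :
    Real.exp (∑ i, (e i : ℝ) * P.E i) ≤ P.𝔅 := by
  refine P.exp_le_𝔅 ?_
  have h1 : ∑ i, (e i : ℝ) * P.E i ≤ 2 * (P.S₀ * ∑ i, (P.Lf i : ℝ) * P.E i) := by
    rw [mul_sum, mul_sum]
    refine sum_le_sum fun i _ => ?_
    have : (e i : ℝ) ≤ 2 * P.Lf i * P.S₀ := by exact_mod_cast he i
    have hE := (P.E_pos i).le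
    calc (e i : ℝ) * P.E i ≤ (2 * P.Lf i * P.S₀) * P.E i := mul_le_mul_of_nonneg_right this hE
      _ = 2 * (P.S₀ * ((P.Lf i : ℝ) * P.E i)) := by ring
  have h2 := P.S₀_sum_Lf_E_le
  have h3 : 2 * (P.S₀ * ∑ i, (P.Lf i : ℝ) * P.E i) ≤ P.Uν := by
    have hd : 2 * ((S.d : ℝ) + 1) ≤ P.ν := by
      have := P.dlog_le'; have := P.log_nu_nonneg
      nlinarith
    have h0 : 0 ≤ P.S₀ * ∑ i, (P.Lf i : ℝ) * P.E i := by
      have : 0 ≤ ∑ i, (P.Lf i : ℝ) * P.E i := sum_nonneg fun i _ => by have := P.E_pos i; positivity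
      positivity
    have hU := P.Uν_pos
    nlinarith
  linarith [P.Uν_le_βU, P.Uν_pos]

/-- **The denominators `∏ den(αⱼ)^{eⱼ} · den θ^{e_θ} ≤ 𝔅`** when `eⱼ ≤ 2 Lⱼ S₀`, `e_θ ≤ 2 L_θ S₀`.
[folklore] -/
theorem Hyp.den_prod_le {e : Fin S.d → ℕ} {eθ : ℕ} (he : ∀ j, e j ≤ 2 * P.L j * P.S₀)
    (heθ : eθ ≤ 2 * P.Lθ * P.S₀) :
    (((∏ j, (S.α j).den ^ e j) * S.θ.den ^ eθ : ℕ) : ℝ) ≤ P.𝔅 := by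
  set e' : Fin (S.d + 1) → ℕ := Fin.snoc e eθ with he'
  have hall : (((∏ j, (S.α j).den ^ e j) * S.θ.den ^ eθ : ℕ) : ℝ) = ∏ i, ((S.all i).den : ℝ) ^ e' i := by
    push_cast
    rw [Fin.prod_univ_castSucc]
    unfold all
    simp only [he', Fin.snoc_castSucc, Fin.snoc_last]
  rw [hall]
  have he'' : ∀ i, e' i ≤ 2 * P.Lf i * P.S₀ := by
    intro i
    refine Fin.lastCases ?_ (fun j => ?_) i
    · simp only [he', Fin.snoc_last]; exact heθ
    · simp only [he', Fin.snoc_castSucc]; exact he j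
  refine le_trans ?_ (exp_sum_le P he'')
  rw [Real.exp_sum]
  refine prod_le_prod (fun i _ => by positivity) fun i _ => ?_
  exact le_trans (pow_le_pow_left₀ (by positivity) (den_le_hgt _) _) (hy.hgt_pow_le i (e' i))

/-- **`|qE(u, s)| ≤ 𝔅`** on the box of level `0`, `s ≤ S₀`. [folklore] -/
theorem Hyp.abs_qE_le {u : Idx S.d P.R P.Lb} (hu : u ∈ S.box (h := P.R) (Lb := P.Lb) P.L P.Lθ 0)
    {s : ℕ} (hs : s ≤ P.S₀) : |(S.qE u s : ℝ)| ≤ P.𝔅 := by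
  rw [S.mem_box] at hu
  simp only [pow_zero, Nat.div_one] at hu
  unfold qE; push_cast
  rw [abs_of_nonneg (by
    refine mul_nonneg (prod_nonneg fun j _ => pow_nonneg ?_ _) (pow_nonneg ?_ _)
    · exact_mod_cast (S.α_pos j).le
    · exact_mod_cast S.θ_pos.le)]
  set e' : Fin (S.d + 1) → ℕ := Fin.snoc (fun j => u.2.1 j * s) (u.2.2 * s) with he'
  have hall : (∏ j, (S.α j : ℝ) ^ (u.2.1 j * s)) * (S.θ : ℝ) ^ (u.2.2 * s) = ∏ i, ((S.all i : ℚ) : ℝ) ^ e' i := by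
    rw [Fin.prod_univ_castSucc]
    unfold all
    simp only [he', Fin.snoc_castSucc, Fin.snoc_last]
  rw [hall]
  have he'' : ∀ i, e' i ≤ 2 * P.Lf i * P.S₀ := by
    intro i
    refine Fin.lastCases ?_ (fun j => ?_) i
    · simp only [he', Fin.snoc_last]
      calc u.2.2 * s ≤ P.Lθ * P.S₀ := Nat.mul_le_mul hu.2 hs
        _ ≤ 2 * P.Lf (Fin.last S.d) * P.S₀ := by unfold Par.Lθ; nlinarith
    · simp only [he', Fin.snoc_castSucc]
      calc u.2.1 j * s ≤ P.L j * P.S₀ := Nat.mul_le_mul (hu.1 j) hs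
        _ ≤ 2 * P.Lf (Fin.castSucc j) * P.S₀ := by unfold Par.L; nlinarith
  refine le_trans ?_ (exp_sum_le P he'')
  rw [Real.exp_sum]
  refine prod_le_prod (fun i _ => pow_nonneg (by exact_mod_cast (S.all_pos i).le) _) fun i _ => ?_
  exact le_trans (pow_le_pow_left₀ (by exact_mod_cast (S.all_pos i).le) (self_le_hgt _) _) (hy.hgt_pow_le i (e' i))

/-- **`|qEh(u, s)| ≤ 𝔅`** on the box of level `J`, `s ≤ 2^{J+1} S₀`. [folklore] -/
theorem Hyp.abs_qEh_le {J : ℕ} {u : Idx S.d P.R P.Lb} (hu : u ∈ S.box (h := P.R) (Lb := P.Lb) P.L P.Lθ J)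
    {s : ℕ} (hs : s ≤ 2 ^ (J + 1) * P.S₀) : |(S.qEh u s : ℝ)| ≤ P.𝔅 := by
  rw [S.mem_box] at hu
  unfold qEh; push_cast
  rw [abs_of_nonneg (prod_nonneg fun i _ => pow_nonneg (by exact_mod_cast (S.all_pos i).le) _)]
  have hdiv : ∀ (lam Lq : ℕ), lam ≤ Lq / 2 ^ J → lam * s / 2 ≤ 2 * Lq * P.S₀ := by
    intro lam Lq hl
    calc lam * s / 2 ≤ lam * s := Nat.div_le_self _ _
      _ ≤ (Lq / 2 ^ J) * (2 ^ (J + 1) * P.S₀) := Nat.mul_le_mul hl hs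
      _ = 2 * ((Lq / 2 ^ J) * 2 ^ J) * P.S₀ := by rw [pow_succ]; ring
      _ ≤ 2 * Lq * P.S₀ := by
          have := Nat.div_mul_le_self Lq (2 ^ J)
          exact Nat.mul_le_mul_right _ (Nat.mul_le_mul_left _ this)
  have he'' : ∀ i, S.expn u s i / 2 ≤ 2 * P.Lf i * P.S₀ := by
    intro i
    refine Fin.lastCases ?_ (fun j => ?_) i
    · rw [S.expn_last]; exact hdiv _ _ hu.2
    · rw [S.expn_castSucc]; exact hdiv _ _ (hu.1 j)
  refine le_trans ?_ (exp_sum_le P he'')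
  rw [Real.exp_sum]
  refine prod_le_prod (fun i _ => pow_nonneg (by exact_mod_cast (S.all_pos i).le) _) fun i _ => ?_
  exact le_trans (pow_le_pow_left₀ (by exact_mod_cast (S.all_pos i).le) (self_le_hgt _) _) (hy.hgt_pow_le i _)

/-- **`P(all) ≤ 𝔅`** (the height product of Lemma 10). [folklore] -/
theorem Hyp.heightProd_le : heightProd S.all ≤ P.𝔅 := by
  unfold heightProd
  have h1 : ∏ i, hgt (S.all i) ≤ Real.exp (∑ i, P.E i) := by
    rw [Real.exp_sum]
    exact prod_le_prod (fun i _ => (hgt_pos _).le) fun i _ => hy.hgt_le i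
  refine h1.trans (P.exp_le_𝔅 ?_)
  have h2 := P.sum_E_le
  have h3 : ((S.d : ℝ) + 1) * P.Ω ≤ (S.d + 1) * P.Uν :=
    mul_le_mul_of_nonneg_left ((P.Ω_le_X.trans P.X_le_U).trans P.U_le_Uν) (by positivity)
  have h4 : ((S.d : ℝ) + 1) * P.Uν ≤ P.β * P.Uν := by
    apply mul_le_mul_of_nonneg_right _ P.Uν_pos.le
    have := P.β_ge; unfold Par.β at *
    have := P.log_nu_nonneg; nlinarith
  linarith

omit hy in
/-- **`(2 Cl)^t ≤ 𝔅`** with `Cl = 1 + (d+1) Ω ≥ 1 + ∑|lⱼ|` and `t ≤ T`. [folklore] -/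
theorem two_Cl_pow_le (P : Par S.d) {t : ℕ} (ht : t ≤ P.T) : (2 * (1 + (S.d + 1) * P.Ω)) ^ t ≤ P.𝔅 := by
  have hΩ := P.one_le_Ω
  have hd := Nat.cast_nonneg (α := ℝ) S.d
  have hC1 : (1 : ℝ) ≤ 2 * (1 + (S.d + 1) * P.Ω) := by nlinarith
  refine (pow_le_pow_right₀ hC1 ht).trans (P.le_𝔅_of_log_le ?_)
  rw [Real.log_pow]
  have hlog : Real.log (2 * (1 + (S.d + 1) * P.Ω)) ≤ (S.d + 2) + P.lΩ := by
    have h4 : 2 * (1 + (S.d + 1) * P.Ω) ≤ (4 * (S.d + 1)) * P.Ω := by nlinarith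
    have h5 : Real.log (2 * (1 + (S.d + 1) * P.Ω)) ≤ Real.log ((4 * (S.d + 1)) * P.Ω) :=
      Real.log_le_log (by positivity) h4
    rw [Real.log_mul (by positivity) P.Ω_pos.ne'] at h5
    have h6 : Real.log (4 * ((S.d : ℝ) + 1)) ≤ S.d + 2 := by
      have := Real.add_one_le_exp ((S.d : ℝ) + 2)
      have h7 : 4 * ((S.d : ℝ) + 1) ≤ Real.exp (S.d + 2) := by
        have := Real.add_one_le_exp ((S.d : ℝ))
        have h8 : Real.exp ((S.d : ℝ) + 2) = Real.exp S.d * Real.exp 2 := Real.exp_add _ _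
        have h9 : (4 : ℝ) ≤ Real.exp 2 := by
          have := Real.add_one_le_exp (1 : ℝ)
          have : Real.exp 2 = Real.exp 1 * Real.exp 1 := by rw [← Real.exp_add]; norm_num
          nlinarith [Real.exp_one_gt_two]
        rw [h8]; nlinarith [Real.exp_pos (S.d : ℝ)]
      calc Real.log (4 * ((S.d : ℝ) + 1)) ≤ Real.log (Real.exp (S.d + 2)) := Real.log_le_log (by positivity) h7
        _ = S.d + 2 := Real.log_exp _
    unfold Par.lΩ; linarith
  calc (P.T : ℝ) * Real.log (2 * (1 + (S.d + 1) * P.Ω)) ≤ P.T * ((S.d + 2) + P.lΩ) :=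
        mul_le_mul_of_nonneg_left hlog P.T_pos.le
    _ = P.T * (0 * Real.log P.ν + 1 * P.lΩ + 0 * P.W₀) + P.T * (S.d + 2) := by ring
    _ ≤ P.Uν + P.Uν := by
        refine add_le_add (T_lin_le P le_rfl zero_le_one le_rfl (by positivity) (by norm_num) (by norm_num)) ?_
        have h8 := P.T_le'; have h9 := P.dlog_le'; have h10 := P.log_nu_nonneg; have h11 := P.T_pos
        have hd2 : (S.d : ℝ) + 2 ≤ P.ν := by nlinarith
        calc (P.T : ℝ) * (S.d + 2) ≤ P.T * P.ν := mul_le_mul_of_nonneg_left hd2 h11.le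
          _ ≤ P.Uν := by nlinarith
    _ ≤ P.β * P.Uν := by linarith [P.Uν_le_βU, P.Uν_pos]

omit hy in
/-- **`14 L_θ S₀ ≤ 𝔅`** (for the smallness parameter `x` of Lemma 9). [folklore] -/
theorem LθS₀_le (P : Par S.d) : 14 * ((P.Lθ : ℝ) * P.S₀) ≤ P.𝔅 := by
  have h1 := P.LfS₀_le (Fin.last S.d)
  have hν := P.nu_ge
  have h2 : 14 * ((P.Lθ : ℝ) * P.S₀) ≤ P.Uν := by
    unfold Par.Lθ
    have h0 : (0 : ℝ) ≤ (P.Lf (Fin.last S.d) : ℝ) * P.S₀ := by positivity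
    nlinarith
  have h3 : P.Uν ≤ P.β * P.Uν := le_trans (by linarith [P.Uν_pos]) P.Uν_le_βU
  refine h2.trans (le_trans ?_ (P.exp_le_𝔅 h3))
  linarith [Real.add_one_le_exp P.Uν]

/-- `|ψ(u)| ≤ (∑ Lᵢ Eᵢ) / 2^J` on the box of level `J`. [folklore] -/
theorem Hyp.abs_ψ_le {J : ℕ} {u : Idx S.d P.R P.Lb} (hu : u ∈ S.box (h := P.R) (Lb := P.Lb) P.L P.Lθ J) :
    |S.ψ u| ≤ (∑ i, (P.Lf i : ℝ) * P.E i) / 2 ^ J := by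
  rw [S.mem_box] at hu
  unfold ψ
  have hcast : ∀ (lam Lq : ℕ), lam ≤ Lq / 2 ^ J → (lam : ℝ) ≤ (Lq : ℝ) / 2 ^ J := by
    intro lam Lq h
    calc (lam : ℝ) ≤ ((Lq / 2 ^ J : ℕ) : ℝ) := by exact_mod_cast h
      _ ≤ (Lq : ℝ) / 2 ^ J := by
          have := Nat.cast_div_le (α := ℝ) (m := Lq) (n := 2 ^ J)
          push_cast at this; exact this
  have h1 : |∑ j, (u.2.1 j : ℝ) * S.l j + (u.2.2 : ℝ) * S.lθ| ≤
      ∑ j, (P.L j : ℝ) / 2 ^ J * P.E (Fin.castSucc j) + (P.Lθ : ℝ) / 2 ^ J * P.E (Fin.last S.d) := by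
    refine (abs_add_le _ _).trans (add_le_add ((abs_sum_le_sum_abs _ _).trans (sum_le_sum fun j _ => ?_)) ?_)
    · rw [abs_mul, Nat.abs_cast]
      exact mul_le_mul (hcast _ _ (hu.1 j)) (hy.abs_l_le j) (abs_nonneg _) (by positivity)
    · rw [abs_mul, Nat.abs_cast]
      exact mul_le_mul (hcast _ _ hu.2) hy.abs_lθ_le (abs_nonneg _) (by positivity)
  refine h1.trans (le_of_eq ?_)
  rw [Fin.sum_univ_castSucc, add_div, sum_div]
  unfold Par.L Par.Lθ
  congr 1
  · exact sum_congr rfl fun j _ => by ring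
  · ring

/-- `|ψ(u) + λ_θ Λ₀| ≤ (∑ Lᵢ Eᵢ + 1) / 2^J` on the box of level `J`, when `L_θ |Λ₀| ≤ 1`. [folklore] -/
theorem Hyp.abs_expo_le {J : ℕ} {u : Idx S.d P.R P.Lb} (hu : u ∈ S.box (h := P.R) (Lb := P.Lb) P.L P.Lθ J)
    (hΛ : (P.Lθ : ℝ) * |S.Λ₀| ≤ 1) :
    |S.expo u| ≤ (∑ i, (P.Lf i : ℝ) * P.E i + 1) / 2 ^ J := by
  have h1 := hy.abs_ψ_le hu
  rw [S.mem_box] at hu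
  unfold expo
  have h2 : |(u.2.2 : ℝ) * S.Λ₀| ≤ 1 / 2 ^ J := by
    rw [abs_mul, Nat.abs_cast]
    have h3 : (u.2.2 : ℝ) ≤ (P.Lθ : ℝ) / 2 ^ J := by
      calc (u.2.2 : ℝ) ≤ ((P.Lθ / 2 ^ J : ℕ) : ℝ) := by exact_mod_cast hu.2
        _ ≤ (P.Lθ : ℝ) / 2 ^ J := by
            have := Nat.cast_div_le (α := ℝ) (m := P.Lθ) (n := 2 ^ J)
            push_cast at this; exact this
    calc (u.2.2 : ℝ) * |S.Λ₀| ≤ (P.Lθ : ℝ) / 2 ^ J * |S.Λ₀| := mul_le_mul_of_nonneg_right h3 (abs_nonneg _)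
      _ = (P.Lθ : ℝ) * |S.Λ₀| / 2 ^ J := by ring
      _ ≤ 1 / 2 ^ J := div_le_div_of_nonneg_right hΛ (by positivity)
  calc |S.ψ u + (u.2.2 : ℝ) * S.Λ₀| ≤ |S.ψ u| + |(u.2.2 : ℝ) * S.Λ₀| := abs_add_le _ _
    _ ≤ (∑ i, (P.Lf i : ℝ) * P.E i) / 2 ^ J + 1 / 2 ^ J := add_le_add h1 h2
    _ = (∑ i, (P.Lf i : ℝ) * P.E i + 1) / 2 ^ J := by ring

omit hy in
/-- **`exp(Ψ_J · 7 · 2^J S₀) ≤ 𝔅`** with `Ψ_J = (∑ Lᵢ Eᵢ + 1)/2^J`. [folklore] -/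
theorem exp_Ψ_le (P : Par S.d) (J : ℕ) :
    Real.exp ((∑ i, (P.Lf i : ℝ) * P.E i + 1) / 2 ^ J * (7 * ((2 ^ J * P.S₀ : ℕ) : ℝ))) ≤ P.𝔅 := by
  refine P.exp_le_𝔅 ?_
  have h2 : (0 : ℝ) < 2 ^ J := by positivity
  have e1 : (∑ i, (P.Lf i : ℝ) * P.E i + 1) / 2 ^ J * (7 * ((2 ^ J * P.S₀ : ℕ) : ℝ)) =
      7 * (P.S₀ * ∑ i, (P.Lf i : ℝ) * P.E i) + 7 * P.S₀ := by
    rw [div_mul_eq_mul_div, div_eq_iff h2.ne']; push_cast; ring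
  rw [e1]
  have h3 := P.S₀_sum_Lf_E_le; have h4 := P.S₀_le'
  have hν := P.nu_ge; have hU := P.Uν_pos
  have h0 : 0 ≤ P.S₀ * ∑ i, (P.Lf i : ℝ) * P.E i := by
    have : 0 ≤ ∑ i, (P.Lf i : ℝ) * P.E i := sum_nonneg fun i _ => by have := P.E_pos i; positivity
    positivity
  have hd : 7 * ((S.d : ℝ) + 1) + 7 ≤ P.ν := by
    have := P.dlog_le'; have := P.log_nu_nonneg; nlinarith
  have : 7 * (P.S₀ * ∑ i, (P.Lf i : ℝ) * P.E i) + 7 * P.S₀ ≤ P.Uν := by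
    have h5 : P.ν * (7 * (P.S₀ * ∑ i, (P.Lf i : ℝ) * P.E i) + 7 * P.S₀) ≤ (7 * ((S.d : ℝ) + 1) + 7) * P.Uν := by
      nlinarith
    exact P.le_Uν_of h5 hd
  linarith [P.Uν_le_βU]

end Setup

end Literature.NumberTheory.Transcendental.CW77

end

noncomputable section

open Complex Finset Polynomial
open Literature.NumberTheory.Transcendental.Baker1975
open Literature.NumberTheory.Transcendental.Baker1975.Ch3

namespace Literature.NumberTheory.Transcendental.CW77

namespace Setup

/-- `#tauSet d T ≤ T^{d+1}`. [folklore] -/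
theorem card_tauSet_le (d T : ℕ) : (tauSet d T).card ≤ T ^ (d + 1) := by
  unfold tauSet
  refine (card_filter_le _ _).trans ?_
  rw [card_product, Fintype.card_piFinset, card_range, prod_const, card_univ, Fintype.card_fin, pow_succ']

variable {S : Setup} {P : Par S.d}

/-- The cardinality of the box of level `J`. [folklore] -/
theorem card_box (S : Setup) (R Lb : ℕ) (L : Fin S.d → ℕ) (Lθ J : ℕ) :
    (S.box (h := R) (Lb := Lb) L Lθ J).card = R * Lb * ((∏ j, (L j / 2 ^ J + 1)) * (Lθ / 2 ^ J + 1)) := by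
  unfold box
  rw [card_product, card_product, card_univ, Fintype.card_prod, Fintype.card_fin, Fintype.card_fin,
    Fintype.card_piFinset, card_range]
  simp only [card_range]

/-- **`#box_J ≤ 𝔅`**. [folklore] -/
theorem card_box_le_𝔅 (P : Par S.d) (J : ℕ) : ((S.box (h := P.R) (Lb := P.Lb) P.L P.Lθ J).card : ℝ) ≤ P.𝔅 := by
  rw [S.card_box]
  push_cast
  have hU := P.Uν_pos
  have hRLb : (P.R : ℝ) * P.Lb ≤ P.Uν := by
    have := P.RLb_le'; have := P.nu_ge; nlinarith
  have hLf : ∀ i, ((P.Lf i / 2 ^ J : ℕ) : ℝ) + 1 ≤ P.Uν := by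
    intro i
    have h1 : ((P.Lf i / 2 ^ J : ℕ) : ℝ) ≤ P.Lf i := by exact_mod_cast Nat.div_le_self _ _
    have h2 := P.Lf_le' i
    have h3 : (P.ν : ℝ) ^ (2 * S.d + 2) * P.X / 2 + 1 ≤ P.Uν := by
      have h4 : (P.ν : ℝ) ^ (2 * S.d + 2) * P.X ≤ (P.ν : ℝ) ^ (2 * S.d + 5) * P.U :=
        mul_le_mul (P.nu_pow_le_pow (by omega)) P.X_le_U P.X_pos.le (by positivity)
      have h5 : (2 : ℝ) ≤ (P.ν : ℝ) ^ (2 * S.d + 2) * P.X := by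
        nlinarith [P.one_le_nu_pow (2 * S.d + 2), P.two_le_X]
      unfold Par.Uν; linarith
    linarith
  have hprod : (∏ j, (((P.L j / 2 ^ J : ℕ) : ℝ) + 1)) ≤ P.Uν ^ S.d := by
    calc (∏ j, (((P.L j / 2 ^ J : ℕ) : ℝ) + 1)) ≤ ∏ _j : Fin S.d, P.Uν :=
          prod_le_prod (fun j _ => by positivity) fun j _ => hLf (Fin.castSucc j)
      _ = P.Uν ^ S.d := by simp
  have htot : (P.R : ℝ) * P.Lb * ((∏ j, (((P.L j / 2 ^ J : ℕ) : ℝ) + 1)) * (((P.Lθ / 2 ^ J : ℕ) : ℝ) + 1)) ≤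
      P.Uν ^ (S.d + 2) := by
    calc (P.R : ℝ) * P.Lb * ((∏ j, (((P.L j / 2 ^ J : ℕ) : ℝ) + 1)) * (((P.Lθ / 2 ^ J : ℕ) : ℝ) + 1))
        ≤ P.Uν * (P.Uν ^ S.d * P.Uν) := by
          refine mul_le_mul hRLb (mul_le_mul hprod (hLf (Fin.last S.d)) (by positivity) (by positivity))
            (by positivity) hU.le
      _ = P.Uν ^ (S.d + 2) := by ring
  refine htot.trans (P.le_𝔅_of_log_le ?_)
  rw [Real.log_pow]
  have hlog := P.log_Uν_le
  have hν := P.nu_ge; have hν0 := P.nu_pos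
  have hd : ((S.d : ℝ) + 2) * 2 ≤ P.ν := by
    have := P.dlog_le'; have := P.log_nu_nonneg; nlinarith
  have hlog' : 0 ≤ Real.log P.Uν := Real.log_nonneg (by linarith [P.four_le_Uν])
  calc ((S.d + 2 : ℕ) : ℝ) * Real.log P.Uν = ((S.d : ℝ) + 2) * Real.log P.Uν := by push_cast; ring
    _ ≤ P.Uν := by
        have h1 : ((S.d : ℝ) + 2) * Real.log P.Uν * P.ν ≤ ((S.d : ℝ) + 2) * (2 * P.Uν) := by
          have := mul_le_mul_of_nonneg_left hlog (show (0:ℝ) ≤ (S.d : ℝ) + 2 by positivity)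
          linarith [this]
        nlinarith
    _ ≤ P.β * P.Uν := by linarith [P.Uν_le_βU]

/-- **The count of Step 1**: twice the number of equations `(s, τ)` is at most the number of
unknowns. [cite: CijsouwWaldschmidt1977, §4 Step 1 (p. 186)] -/
theorem siegel_count (S : Setup) (P : Par S.d) :
    2 * ((range P.S₀) ×ˢ tauSet S.d P.T).card ≤ (S.box (h := P.R) (Lb := P.Lb) P.L P.Lθ 0).card := by
  rw [S.card_box, card_product, card_range]
  simp only [pow_zero, Nat.div_one]
  have h1 : 2 * (P.S₀ * (tauSet S.d P.T).card) ≤ 2 * (P.S₀ * P.T ^ (S.d + 1)) :=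
    Nat.mul_le_mul_left _ (Nat.mul_le_mul_left _ (card_tauSet_le _ _))
  refine h1.trans ?_
  -- pass to the reals
  have hprod : (∏ j, (P.L j + 1)) * (P.Lθ + 1) = ∏ i, (P.Lf i + 1) := by
    rw [Fin.prod_univ_castSucc]; rfl
  rw [hprod]
  have key : (2 : ℝ) * (P.S₀ * (P.T : ℝ) ^ (S.d + 1)) ≤ P.R * P.Lb * ∏ i, ((P.Lf i : ℝ) + 1) := by
    set Y := (P.ν : ℝ) ^ (2 * S.d + 2) * P.X with hY
    have hY0 : 0 < Y := by rw [hY]; exact mul_pos (pow_pos P.nu_pos _) P.X_pos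
    have hT : (P.T : ℝ) ≤ (P.ν : ℝ) ^ 2 * Y := by
      have := P.T_le
      have e : (P.ν : ℝ) ^ (2 * S.d + 4) * P.X = (P.ν : ℝ) ^ 2 * Y := by rw [hY]; ring
      linarith
    have hS := P.S₀_le
    have hRLb := P.RLb_ge
    have hΩ := P.Ω_pos
    -- `∏ (Lf i + 1) ≥ ∏ Y / E i = Y^{d+1} / Ω`
    have hP : Y ^ (S.d + 1) / P.Ω ≤ ∏ i, ((P.Lf i : ℝ) + 1) := by
      have e1 : Y ^ (S.d + 1) / P.Ω = ∏ i, (Y / P.E i) := by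
        rw [prod_div_distrib, prod_const, card_univ, Fintype.card_fin]; rfl
      rw [e1]
      exact prod_le_prod (fun i _ => by have := P.E_pos i; positivity) fun i _ => by rw [hY]; exact P.Lf_succ_ge i
    have hW := P.W₀_pos
    have lhs : (2 : ℝ) * (P.S₀ * (P.T : ℝ) ^ (S.d + 1)) ≤ 2 * ((P.ν : ℝ) ^ 2 * P.W₀) * (((P.ν : ℝ) ^ 2) ^ (S.d + 1) * Y ^ (S.d + 1)) := by
      have h2 : (P.T : ℝ) ^ (S.d + 1) ≤ ((P.ν : ℝ) ^ 2 * Y) ^ (S.d + 1) := pow_le_pow_left₀ P.T_pos.le hT _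
      rw [mul_pow] at h2
      have h3 : (0 : ℝ) ≤ P.S₀ := Nat.cast_nonneg _
      nlinarith [mul_le_mul hS h2 (by positivity) (by positivity)]
    have rhs : 3 * (P.ν : ℝ) ^ (2 * S.d + 4) * P.Ω * P.W₀ * (Y ^ (S.d + 1) / P.Ω) ≤ P.R * P.Lb * ∏ i, ((P.Lf i : ℝ) + 1) :=
      mul_le_mul hRLb hP (by positivity) (by positivity)
    have e2 : 3 * (P.ν : ℝ) ^ (2 * S.d + 4) * P.Ω * P.W₀ * (Y ^ (S.d + 1) / P.Ω) =
        3 * ((P.ν : ℝ) ^ 2 * P.W₀) * (((P.ν : ℝ) ^ 2) ^ (S.d + 1) * Y ^ (S.d + 1)) := by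
      field_simp
      ring
    rw [e2] at rhs
    have h0 : (0 : ℝ) ≤ ((P.ν : ℝ) ^ 2 * P.W₀) * (((P.ν : ℝ) ^ 2) ^ (S.d + 1) * Y ^ (S.d + 1)) := by positivity
    linarith
  exact_mod_cast key

/-- **`ν(x, R)^k ≤ 𝔅`** for `x ≤ T S₀`, `k ≤ T` — the main term `c₄ ν^{2n+3} U` of the sizes
(Cijsouw–Waldschmidt (7): "`ν(R) ≤ c₄^{ν(log B + log log A)}`").
[cite: CijsouwWaldschmidt1977, §4 (7) (p. 184)] [cite: BakerTNT1975, Ch. 3 §2 Lemma 1] -/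
theorem nuBound_pow_le_𝔅 (P : Par S.d) {x k : ℕ} (hx : x ≤ P.T * P.S₀) (hk : k ≤ P.T) :
    ((nuBound x P.R : ℕ) : ℝ) ^ k ≤ P.𝔅 := by
  have hν1 : (1 : ℝ) ≤ nuBound x P.R := by exact_mod_cast nuBound_pos x P.R
  refine (pow_le_pow_right₀ hν1 hk).trans (P.le_𝔅_of_log_le ?_)
  rw [Real.log_pow]
  have h1 := log_nuBound_le (x := x) P.two_le_R
  have h2 := P.log_ratio_le (c := 1) (x := x) (by simpa using hx)
  have hl2 : Real.log ((1 : ℕ) + 1 : ℝ) ≤ 0.7 := by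
    norm_num; exact Real.log_two_lt_d9.le.trans (by norm_num)
  have hR := P.R_pos; have hT := P.T_pos; have hl := P.log_nu_nonneg; have hlΩ := P.one_le_lΩ
  have hd := Nat.cast_nonneg (α := ℝ) S.d
  have h3 : Real.log (nuBound x P.R) ≤ P.R * (12.3 + 9 * (2 * S.d + 5) * Real.log P.ν + 27 * P.lΩ) := by
    refine h1.trans (mul_le_mul_of_nonneg_left ?_ hR.le)
    push_cast at h2 hl2 ⊢
    nlinarith
  have hRT := P.RT_le; have hRTl := P.RTlΩ_le; have hU := P.Uν_pos; have hν := P.nu_ge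
  have hRT' : (P.R : ℝ) * P.T ≤ 2 * P.Uν := by
    have : P.Uν / (2 * P.ν) ≤ P.Uν := div_le_self hU.le (by linarith)
    linarith
  have hRTl' : (P.R : ℝ) * P.T * P.lΩ ≤ 2 * P.Uν := by
    have : P.Uν / P.ν ≤ P.Uν := div_le_self hU.le (by linarith)
    linarith
  calc (P.T : ℝ) * Real.log (nuBound x P.R)
      ≤ P.T * (P.R * (12.3 + 9 * (2 * S.d + 5) * Real.log P.ν + 27 * P.lΩ)) := mul_le_mul_of_nonneg_left h3 hT.le
    _ = (P.R * P.T) * (12.3 + 9 * (2 * S.d + 5) * Real.log P.ν) + 27 * (P.R * P.T * P.lΩ) := by ring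
    _ ≤ (2 * P.Uν) * (12.3 + 9 * (2 * S.d + 5) * Real.log P.ν) + 27 * (2 * P.Uν) := by
        refine add_le_add (mul_le_mul_of_nonneg_right hRT' (by positivity)) (by linarith)
    _ = (78.6 + (36 * S.d + 90) * Real.log P.ν) * P.Uν := by ring
    _ ≤ P.β * P.Uν := by
        refine mul_le_mul_of_nonneg_right ?_ hU.le
        unfold Par.β; nlinarith

/-- `(e (x + R)/R)^{R L_b} ≤ exp 𝔘` for `x ≤ 7 T S₀` (the binomial factors of the `Δ`-polynomials).
[cite: CijsouwWaldschmidt1977, §4 (8) (p. 184)] -/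
theorem ratio_pow_le (P : Par S.d) {x : ℕ} (hx : x ≤ 7 * (P.T * P.S₀)) :
    (Real.exp 1 * ((x : ℝ) + P.R) / P.R) ^ (P.R * P.Lb) ≤ Real.exp P.Uν := by
  have hR := P.R_pos
  have hbase : 1 ≤ Real.exp 1 * ((x : ℝ) + P.R) / P.R := by
    rw [le_div_iff₀ hR]
    have := Real.exp_one_gt_two; have := Nat.cast_nonneg (α := ℝ) x
    nlinarith
  have hpos : 0 < Real.exp 1 * ((x : ℝ) + P.R) / P.R := by linarith
  rw [← Real.exp_log hpos, ← Real.exp_nat_mul, Real.exp_le_exp]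
  have h1 : Real.log (Real.exp 1 * ((x : ℝ) + P.R) / P.R) = 1 + Real.log (((x : ℝ) + P.R) / P.R) := by
    rw [mul_div_assoc, Real.log_mul (Real.exp_pos 1).ne' (by positivity), Real.log_exp]
  rw [h1]
  have h2 := P.log_ratio_le (c := 7) hx
  have hl8 : Real.log ((7 : ℕ) + 1 : ℝ) ≤ 2.1 := by
    have : Real.log ((7 : ℕ) + 1 : ℝ) = 3 * Real.log 2 := by
      rw [← Real.log_rpow two_pos]; norm_num
    rw [this]; linarith [Real.log_two_lt_d9]
  push_cast at h2 hl8 ⊢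
  have hd := Nat.cast_nonneg (α := ℝ) S.d
  calc ((P.R : ℝ) * P.Lb) * (1 + Real.log (((x : ℝ) + P.R) / P.R))
      ≤ ((P.R : ℝ) * P.Lb) * ((2 * S.d + 5) * Real.log P.ν + 3 * P.lΩ + 3.1) := by
        refine mul_le_mul_of_nonneg_left ?_ (by positivity); linarith
    _ ≤ P.Uν := RLb_lin_le P (by positivity) (by norm_num) (by norm_num) (by linarith) (by norm_num) (by norm_num)

/-- `T log T ≤ 𝔘`, i.e. `T^T ≤ exp 𝔘`. [folklore] -/
theorem T_pow_T_le (P : Par S.d) : (P.T : ℝ) ^ P.T ≤ Real.exp P.Uν := by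
  have hT := P.T_pos
  rw [← Real.exp_log hT, ← Real.exp_nat_mul, Real.exp_le_exp]
  have hd := Nat.cast_nonneg (α := ℝ) S.d
  calc (P.T : ℝ) * Real.log P.T ≤ P.T * ((2 * S.d + 4) * Real.log P.ν + 2 * P.lΩ + 0 * P.W₀) := by
        refine mul_le_mul_of_nonneg_left ?_ hT.le; linarith [P.log_T_le]
    _ ≤ P.Uν := T_lin_le P (by positivity) (by norm_num) le_rfl (by linarith) (by norm_num) (by norm_num)

/-- `2^{R L_b} ≤ exp 𝔘`. [folklore] -/
theorem two_pow_RLb_le (P : Par S.d) : (2 : ℝ) ^ (P.R * P.Lb) ≤ Real.exp P.Uν := by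
  have h2 : (2 : ℝ) = Real.exp (Real.log 2) := (Real.exp_log two_pos).symm
  rw [h2, ← Real.exp_nat_mul, Real.exp_le_exp]
  push_cast
  calc ((P.R : ℝ) * P.Lb) * Real.log 2 ≤ ((P.R : ℝ) * P.Lb) * (0 * Real.log P.ν + 0 * P.lΩ + 1) := by
        refine mul_le_mul_of_nonneg_left ?_ (by positivity); linarith [Real.log_two_lt_d9]
    _ ≤ P.Uν := RLb_lin_le P le_rfl le_rfl zero_le_one (by positivity) (by norm_num) (by norm_num)

/-- `exp(4 𝔘) ≤ 𝔅`. [folklore] -/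
theorem exp_four_Uν_le (P : Par S.d) : Real.exp (4 * P.Uν) ≤ P.𝔅 :=
  P.exp_le_𝔅 (by linarith [P.Uν_le_βU, P.Uν_pos])

/-- `scale = 2^{J₀ − J} ≤ T`. [folklore] -/
theorem scale_le_T (P : Par S.d) (J : ℕ) : scale P.J₀ J ≤ P.T := by
  unfold scale
  calc 2 ^ (P.J₀ - J) ≤ 2 ^ P.J₀ := Nat.pow_le_pow_right two_pos (Nat.sub_le _ _)
    _ ≤ P.T - 1 := P.two_pow_J₀_le
    _ ≤ P.T := Nat.sub_le _ _

/-- **`|qΔ| ≤ 𝔅`**: the size of the rational values of the `Δ`-factors at the points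
`x = 2^{J₀−J} s ≤ T S₀`, `τ₀ ≤ T` (Cijsouw–Waldschmidt (8)–(9)).
[cite: CijsouwWaldschmidt1977, §4 (8)–(9) (p. 184)] [cite: BakerTNT1975, Ch. 3 §2 Lemma 1] -/
theorem abs_qΔ_le (S : Setup) (P : Par S.d) {J : ℕ} (u : Idx S.d P.R P.Lb) {τ₀ s : ℕ}
    (hx : scale P.J₀ J * s ≤ P.T * P.S₀) (hτ : τ₀ ≤ P.T) :
    |(S.qΔ (h := P.R) P.J₀ J u τ₀ s : ℝ)| ≤ P.𝔅 := by
  set x := scale P.J₀ J * s with hxdef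
  set a : ℕ := (u.1.1 : ℕ) with ha
  set b : ℕ := (u.1.2 : ℕ) with hb
  have haR : a ≤ P.R := le_of_lt u.1.1.isLt
  have hspec := (hdNat_spec (b := b) (le_of_lt u.1.1.isLt) x τ₀).2
  have hνpos : (0 : ℝ) < ((nuBound x P.R) ^ τ₀ : ℕ) := by exact_mod_cast Nat.pow_pos (nuBound_pos _ _)
  -- `|qΔ| = τ₀! scale^{τ₀} E / ν^{τ₀} ≤ τ₀! scale^{τ₀} 2^{a+bR} C(x+a,a) C(x+R,R)^b`
  have h1 : |(S.qΔ (h := P.R) P.J₀ J u τ₀ s : ℝ)| ≤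
      (τ₀.factorial : ℝ) * (scale P.J₀ J : ℝ) ^ τ₀ * (2 ^ (a + b * P.R) * ((x + a).choose a * (x + P.R).choose P.R ^ b : ℕ) : ℝ) := by
    unfold qΔ
    rw [← hxdef]
    push_cast
    rw [abs_of_nonneg (by positivity), div_le_iff₀ (by push_cast at hνpos; exact_mod_cast hνpos)]
    have hE : ((hdNat (b := b) (le_of_lt u.1.1.isLt) x τ₀ : ℕ) : ℝ) ≤
        ((2 ^ (a + b * P.R) * nuBound x P.R ^ τ₀ * ((x + a).choose a * (x + P.R).choose P.R ^ b) : ℕ) : ℝ) := by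
      exact_mod_cast hspec
    push_cast at hE ⊢
    have h0 : (0 : ℝ) ≤ (τ₀.factorial : ℝ) * (scale P.J₀ J : ℝ) ^ τ₀ := by positivity
    calc (τ₀.factorial : ℝ) * (scale P.J₀ J : ℝ) ^ τ₀ * (hdNat (b := b) (le_of_lt u.1.1.isLt) x τ₀ : ℝ)
        ≤ (τ₀.factorial : ℝ) * (scale P.J₀ J : ℝ) ^ τ₀ *
          (2 ^ (a + b * P.R) * (nuBound x P.R : ℝ) ^ τ₀ * (((x + a).choose a : ℝ) * ((x + P.R).choose P.R : ℝ) ^ b)) :=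
          mul_le_mul_of_nonneg_left hE h0
      _ = (τ₀.factorial : ℝ) * (scale P.J₀ J : ℝ) ^ τ₀ *
          (2 ^ (a + b * P.R) * (((x + a).choose a : ℝ) * ((x + P.R).choose P.R : ℝ) ^ b)) * (nuBound x P.R : ℝ) ^ τ₀ := by
          ring
  -- the four factors
  have hf1 : (τ₀.factorial : ℝ) ≤ Real.exp P.Uν := by
    have h2 : (τ₀.factorial : ℝ) ≤ (τ₀ : ℝ) ^ τ₀ := by exact_mod_cast Nat.factorial_le_pow τ₀
    have h3 : (τ₀ : ℝ) ^ τ₀ ≤ (P.T : ℝ) ^ τ₀ := pow_le_pow_left₀ (Nat.cast_nonneg _) (by exact_mod_cast hτ) _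
    have h4 : (P.T : ℝ) ^ τ₀ ≤ (P.T : ℝ) ^ P.T := pow_le_pow_right₀ (by have := P.three_le_T; exact_mod_cast (show 1 ≤ P.T by omega)) hτ
    exact h2.trans (h3.trans (h4.trans (T_pow_T_le P)))
  have hf2 : (scale P.J₀ J : ℝ) ^ τ₀ ≤ Real.exp P.Uν := by
    have h2 : (scale P.J₀ J : ℝ) ≤ P.T := by exact_mod_cast scale_le_T P J
    have h4 : (P.T : ℝ) ^ τ₀ ≤ (P.T : ℝ) ^ P.T := pow_le_pow_right₀ (by have := P.three_le_T; exact_mod_cast (show 1 ≤ P.T by omega)) hτ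
    exact (pow_le_pow_left₀ (Nat.cast_nonneg _) h2 _).trans (h4.trans (T_pow_T_le P))
  have hab : a + b * P.R ≤ P.R * P.Lb := by
    have ha' : a < P.R := u.1.1.isLt
    have hb' : b < P.Lb := u.1.2.isLt
    calc a + b * P.R ≤ P.R + b * P.R := by omega
      _ = (b + 1) * P.R := by ring
      _ ≤ P.Lb * P.R := Nat.mul_le_mul_right _ hb'
      _ = P.R * P.Lb := Nat.mul_comm _ _
  have hf3 : (2 : ℝ) ^ (a + b * P.R) ≤ Real.exp P.Uν :=
    (pow_le_pow_right₀ (by norm_num) hab).trans (two_pow_RLb_le P)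
  have hf4 : (((x + a).choose a * (x + P.R).choose P.R ^ b : ℕ) : ℝ) ≤ Real.exp P.Uν := by
    have hC : ((x + a).choose a : ℝ) ≤ (x + P.R).choose P.R := by
      have : (x + a).choose a ≤ (x + P.R).choose P.R := by
        have e1 : (x + a).choose a = (x + a).choose x := (Nat.choose_symm_add (a := x) (b := a)).symm
        have e2 : (x + P.R).choose P.R = (x + P.R).choose x := (Nat.choose_symm_add (a := x) (b := P.R)).symm
        rw [e1, e2]
        exact Nat.choose_le_choose x (by omega)
      exact_mod_cast this
    have hCe := choose_le_exp_mul_div_pow (x := x) (show 1 ≤ P.R by have := P.two_le_R; omega)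
    have hbase : 1 ≤ Real.exp 1 * ((x : ℝ) + P.R) / P.R := by
      rw [le_div_iff₀ P.R_pos]
      have := Real.exp_one_gt_two; have := Nat.cast_nonneg (α := ℝ) x
      nlinarith
    push_cast
    calc ((x + a).choose a : ℝ) * ((x + P.R).choose P.R : ℝ) ^ b ≤ ((x + P.R).choose P.R : ℝ) ^ (b + 1) := by
          rw [pow_succ]; nlinarith [pow_nonneg (Nat.cast_nonneg (α := ℝ) ((x + P.R).choose P.R)) b]
      _ ≤ ((Real.exp 1 * (x + P.R) / P.R) ^ P.R) ^ (b + 1) := pow_le_pow_left₀ (Nat.cast_nonneg _) hCe _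
      _ = (Real.exp 1 * ((x : ℝ) + P.R) / P.R) ^ (P.R * (b + 1)) := by rw [← pow_mul]
      _ ≤ (Real.exp 1 * ((x : ℝ) + P.R) / P.R) ^ (P.R * P.Lb) := by
          refine pow_le_pow_right₀ hbase (Nat.mul_le_mul_left _ ?_)
          exact u.1.2.isLt
      _ ≤ Real.exp P.Uν := ratio_pow_le P (by omega)
  refine h1.trans ?_
  have hE := Real.exp_pos P.Uν
  calc (τ₀.factorial : ℝ) * (scale P.J₀ J : ℝ) ^ τ₀ *
        (2 ^ (a + b * P.R) * ((x + a).choose a * (x + P.R).choose P.R ^ b : ℕ) : ℝ)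
      ≤ Real.exp P.Uν * Real.exp P.Uν * (Real.exp P.Uν * Real.exp P.Uν) := by
        refine mul_le_mul (mul_le_mul hf1 hf2 (by positivity) hE.le) (mul_le_mul hf3 hf4 (by positivity) hE.le)
          (by positivity) (by positivity)
    _ = Real.exp (4 * P.Uν) := by simp only [← Real.exp_add]; ring_nf
    _ ≤ P.𝔅 := exp_four_Uν_le P

/-- **`|Qw m (w_u(2^{J₀−J} ·)) 0 z| ≤ 𝔅`** for `m ≤ T`, `|z| ≤ 7 · 2^J S₀`, `J ≤ J₀`: the size of the
`Δ`-factors of `f_{J,τ}` on the discs of Step 2 (Cijsouw–Waldschmidt (8)).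
[cite: CijsouwWaldschmidt1977, §4 (8) (p. 184)] -/
theorem norm_Qw_wOf_le (S : Setup) (P : Par S.d) {J : ℕ} (hJ : J ≤ P.J₀) (u : Idx S.d P.R P.Lb) {m : ℕ}
    (hm : m ≤ P.T) {z : ℂ} (hz : ‖z‖ ≤ 7 * ((2 ^ J * P.S₀ : ℕ) : ℝ)) :
    ‖Qw m (S.wOf (h := P.R) P.J₀ J u) 0 z‖ ≤ P.𝔅 := by
  set a : ℕ := (u.1.1 : ℕ) with ha
  set b : ℕ := (u.1.2 : ℕ) with hb
  rw [Qw_zero_right, iterate_derivative_eval_eq_factorial_mul_hasseDeriv, norm_mul, Complex.norm_natCast]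
  have hR1 : 1 ≤ P.R := by have := P.two_le_R; omega
  have h1 := norm_hasseDeriv_wPoly_comp_eval_le (b := b) (le_of_lt u.1.1.isLt) hR1 (2 ^ (P.J₀ - J)) z m
  have hwOf : S.wOf (h := P.R) P.J₀ J u = (wPoly a b P.R).comp (C ((2 ^ (P.J₀ - J) : ℕ) : ℂ) * X) := rfl
  rw [hwOf]
  -- the point `⌈2^{J₀-J} |z|⌉ ≤ 7 T S₀`
  have hceil : ⌈((2 ^ (P.J₀ - J) : ℕ) : ℝ) * ‖z‖⌉₊ ≤ 7 * (P.T * P.S₀) := by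
    refine Nat.ceil_le.mpr ?_
    have h2 : ((2 ^ (P.J₀ - J) : ℕ) : ℝ) * (7 * ((2 ^ J * P.S₀ : ℕ) : ℝ)) = 7 * ((2 ^ P.J₀ : ℕ) : ℝ) * P.S₀ := by
      push_cast
      rw [show (2 : ℝ) ^ P.J₀ = 2 ^ (P.J₀ - J) * 2 ^ J by rw [← pow_add, Nat.sub_add_cancel hJ]]
      ring
    have h3 : ((2 ^ P.J₀ : ℕ) : ℝ) ≤ P.T := by
      have := P.two_pow_J₀_le; exact_mod_cast (show 2 ^ P.J₀ ≤ P.T by omega)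
    calc ((2 ^ (P.J₀ - J) : ℕ) : ℝ) * ‖z‖ ≤ ((2 ^ (P.J₀ - J) : ℕ) : ℝ) * (7 * ((2 ^ J * P.S₀ : ℕ) : ℝ)) :=
          mul_le_mul_of_nonneg_left hz (Nat.cast_nonneg _)
      _ = 7 * ((2 ^ P.J₀ : ℕ) : ℝ) * P.S₀ := h2
      _ ≤ 7 * P.T * P.S₀ := by
          have : (0 : ℝ) ≤ P.S₀ := Nat.cast_nonneg _
          nlinarith
      _ = ((7 * (P.T * P.S₀) : ℕ) : ℝ) := by push_cast; ring
  -- the factors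
  have hf1 : (m.factorial : ℝ) ≤ Real.exp P.Uν := by
    have h2 : (m.factorial : ℝ) ≤ (m : ℝ) ^ m := by exact_mod_cast Nat.factorial_le_pow m
    have h3 : (m : ℝ) ^ m ≤ (P.T : ℝ) ^ m := pow_le_pow_left₀ (Nat.cast_nonneg _) (by exact_mod_cast hm) _
    have h4 : (P.T : ℝ) ^ m ≤ (P.T : ℝ) ^ P.T := pow_le_pow_right₀ (by have := P.three_le_T; exact_mod_cast (show 1 ≤ P.T by omega)) hm
    exact h2.trans (h3.trans (h4.trans (T_pow_T_le P)))
  have hf2 : (((2 ^ (P.J₀ - J) : ℕ) : ℝ)) ^ m ≤ Real.exp P.Uν := by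
    have h2 : ((2 ^ (P.J₀ - J) : ℕ) : ℝ) ≤ P.T := by exact_mod_cast scale_le_T P J
    have h4 : (P.T : ℝ) ^ m ≤ (P.T : ℝ) ^ P.T := pow_le_pow_right₀ (by have := P.three_le_T; exact_mod_cast (show 1 ≤ P.T by omega)) hm
    exact (pow_le_pow_left₀ (Nat.cast_nonneg _) h2 _).trans (h4.trans (T_pow_T_le P))
  have hab : a + b * P.R ≤ P.R * P.Lb := by
    have ha' : a < P.R := u.1.1.isLt
    have hb' : b < P.Lb := u.1.2.isLt
    calc a + b * P.R ≤ P.R + b * P.R := by omega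
      _ = (b + 1) * P.R := by ring
      _ ≤ P.Lb * P.R := Nat.mul_le_mul_right _ hb'
      _ = P.R * P.Lb := Nat.mul_comm _ _
  have hf3 : (2 : ℝ) ^ (a + b * P.R) ≤ Real.exp P.Uν :=
    (pow_le_pow_right₀ (by norm_num) hab).trans (two_pow_RLb_le P)
  have hf4 : (Real.exp 1 * (⌈((2 ^ (P.J₀ - J) : ℕ) : ℝ) * ‖z‖⌉₊ + P.R) / P.R) ^ (P.R * (b + 1)) ≤ Real.exp P.Uν := by
    set y := ⌈((2 ^ (P.J₀ - J) : ℕ) : ℝ) * ‖z‖⌉₊ with hy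
    have hbase : 1 ≤ Real.exp 1 * ((y : ℝ) + P.R) / P.R := by
      rw [le_div_iff₀ P.R_pos]
      have := Real.exp_one_gt_two; have := Nat.cast_nonneg (α := ℝ) y
      nlinarith
    calc (Real.exp 1 * ((y : ℝ) + P.R) / P.R) ^ (P.R * (b + 1))
        ≤ (Real.exp 1 * ((y : ℝ) + P.R) / P.R) ^ (P.R * P.Lb) := by
          refine pow_le_pow_right₀ hbase (Nat.mul_le_mul_left _ ?_); exact u.1.2.isLt
      _ ≤ Real.exp P.Uν := ratio_pow_le P hceil
  have hE := Real.exp_pos P.Uν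
  calc (m.factorial : ℝ) * ‖(hasseDeriv m ((wPoly a b P.R).comp (C ((2 ^ (P.J₀ - J) : ℕ) : ℂ) * X))).eval z‖
      ≤ Real.exp P.Uν * ((((2 ^ (P.J₀ - J) : ℕ) : ℝ)) ^ m * (2 ^ (a + b * P.R) *
          (Real.exp 1 * (⌈((2 ^ (P.J₀ - J) : ℕ) : ℝ) * ‖z‖⌉₊ + P.R) / P.R) ^ (P.R * (b + 1)))) :=
        mul_le_mul hf1 h1 (norm_nonneg _) hE.le
    _ ≤ Real.exp P.Uν * (Real.exp P.Uν * (Real.exp P.Uν * Real.exp P.Uν)) := by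
        refine mul_le_mul_of_nonneg_left (mul_le_mul hf2 (mul_le_mul hf3 hf4 (by positivity) hE.le) (by positivity) hE.le) hE.le
    _ = Real.exp (4 * P.Uν) := by simp only [← Real.exp_add]; ring_nf
    _ ≤ P.𝔅 := exp_four_Uν_le P

/-- **`2 kpts^{t+1} t ≤ 𝔅`** (the polynomial factor of the Hermite interpolation bound).
[folklore] -/
theorem two_kpts_pow_le (P : Par S.d) {J : ℕ} (hJ : J < P.J₀) :
    2 * (((2 ^ J * P.S₀ / 2 : ℕ) : ℝ)) ^ ((P.T / 2 ^ J - P.T / 2 ^ (J + 1) : ℕ) + 1) *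
      ((P.T / 2 ^ J - P.T / 2 ^ (J + 1) : ℕ) : ℝ) ≤ P.𝔅 := by
  set kpts : ℕ := 2 ^ J * P.S₀ / 2 with hk
  set t : ℕ := P.T / 2 ^ J - P.T / 2 ^ (J + 1) with ht
  have hkle : (kpts : ℝ) ≤ (P.T : ℝ) * P.S₀ := P.kpts_le' hJ
  have htle : t ≤ P.T := (Nat.sub_le _ _).trans (Nat.div_le_self _ _)
  have hTS1 : (1 : ℝ) ≤ (P.T : ℝ) * P.S₀ := by
    have h1 : (1 : ℝ) ≤ P.T := by have := P.three_le_T; exact_mod_cast (show 1 ≤ P.T by omega)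
    have h2 : (1 : ℝ) ≤ P.S₀ := by have := P.two_le_S₀; exact_mod_cast (show 1 ≤ P.S₀ by omega)
    nlinarith
  have hT1 : (P.T : ℝ) ≤ (P.T : ℝ) * P.S₀ := by
    have h2 : (1 : ℝ) ≤ P.S₀ := by have := P.two_le_S₀; exact_mod_cast (show 1 ≤ P.S₀ by omega)
    have := P.T_pos; nlinarith
  have h1 : 2 * (kpts : ℝ) ^ (t + 1) * (t : ℝ) ≤ 2 * ((P.T : ℝ) * P.S₀) ^ (P.T + 2) := by
    have h2 : (kpts : ℝ) ^ (t + 1) ≤ ((P.T : ℝ) * P.S₀) ^ (t + 1) := pow_le_pow_left₀ (Nat.cast_nonneg _) hkle _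
    have h3 : ((P.T : ℝ) * P.S₀) ^ (t + 1) ≤ ((P.T : ℝ) * P.S₀) ^ (P.T + 1) :=
      pow_le_pow_right₀ hTS1 (by omega)
    have h4 : (t : ℝ) ≤ (P.T : ℝ) * P.S₀ := le_trans (by exact_mod_cast htle) hT1
    calc 2 * (kpts : ℝ) ^ (t + 1) * (t : ℝ) ≤ 2 * ((P.T : ℝ) * P.S₀) ^ (P.T + 1) * ((P.T : ℝ) * P.S₀) :=
          mul_le_mul (mul_le_mul_of_nonneg_left (h2.trans h3) (by norm_num)) h4 (Nat.cast_nonneg _) (by positivity)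
      _ = 2 * ((P.T : ℝ) * P.S₀) ^ (P.T + 2) := by ring
  refine h1.trans (P.le_𝔅_of_log_le ?_)
  rw [Real.log_mul (by norm_num) (by positivity), Real.log_pow]
  have hlog := P.log_TS₀_le
  have hsm := P.logTS₀_small
  have hd := Nat.cast_nonneg (α := ℝ) S.d
  have hpos : 0 ≤ (2 * S.d + 6) * Real.log P.ν + 3 * P.W₀ := by
    have := P.log_nu_nonneg; have := P.W₀_pos; positivity
  have h5 : ((P.T + 2 : ℕ) : ℝ) * Real.log ((P.T : ℝ) * P.S₀) ≤ P.Uν + P.Uν := by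
    push_cast
    calc ((P.T : ℝ) + 2) * Real.log ((P.T : ℝ) * P.S₀) ≤ ((P.T : ℝ) + 2) * ((2 * S.d + 6) * Real.log P.ν + 3 * P.W₀) :=
          mul_le_mul_of_nonneg_left hlog (by positivity)
      _ = P.T * ((2 * S.d + 6) * Real.log P.ν + 0 * P.lΩ + 3 * P.W₀) + 2 * ((2 * S.d + 6) * Real.log P.ν + 3 * P.W₀) := by ring
      _ ≤ P.Uν + P.Uν := by
          refine add_le_add (T_lin_le P (by positivity) le_rfl (by norm_num) (by linarith) (by norm_num) (by norm_num)) ?_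
          have hν := P.nu_ge; nlinarith
  have hl2 : Real.log 2 ≤ 1 := by linarith [Real.log_two_lt_d9]
  linarith [P.Uν_le_βU, P.four_le_Uν]

end Setup

end Literature.NumberTheory.Transcendental.CW77

end

noncomputable section

open Complex Finset Polynomial
open Literature.NumberTheory.Transcendental.Baker1975
open Literature.NumberTheory.Transcendental.Baker1975.Ch3

namespace Literature.NumberTheory.Transcendental.CW77

namespace Setup

variable {S : Setup} {P : Par S.d} (hy : S.Hyp P)
include hy

omit hy in
/-- `scale(J₀, J') · s ≤ T S₀` when `J' ≤ J₀` and `s ≤ 2^{J'} S₀`. [folklore] -/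
theorem scale_mul_le (P : Par S.d) {J' s : ℕ} (hJ : J' ≤ P.J₀) (hs : s ≤ 2 ^ J' * P.S₀) :
    scale P.J₀ J' * s ≤ P.T * P.S₀ := by
  unfold scale
  have h2 : 2 ^ P.J₀ ≤ P.T := by have := P.two_pow_J₀_le; omega
  calc 2 ^ (P.J₀ - J') * s ≤ 2 ^ (P.J₀ - J') * (2 ^ J' * P.S₀) := Nat.mul_le_mul_left _ hs
    _ = 2 ^ P.J₀ * P.S₀ := by rw [← Nat.mul_assoc, ← pow_add, Nat.sub_add_cancel hJ]
    _ ≤ P.T * P.S₀ := Nat.mul_le_mul_right _ h2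

/-- **The bound `Amax = 𝔅⁶` of Step 1**: `|D(s,τ) · qTerm| ≤ 𝔅⁶` on the box of level `0`.
[cite: CijsouwWaldschmidt1977, §4 Step 1 (pp. 185–186)] -/
theorem Hyp.abs_Dclear_qTerm_le {s : ℕ} (hs : s < P.S₀) {τ : Tau S.d} (hτ : tauNorm τ < P.T)
    {u : Idx S.d P.R P.Lb} (hu : u ∈ S.box (h := P.R) (Lb := P.Lb) P.L P.Lθ 0) :
    |((S.Dclear (h := P.R) P.J₀ P.L P.Lθ s τ : ℕ) : ℝ) * (S.qTerm (h := P.R) P.J₀ 0 u τ s : ℝ)| ≤ P.𝔅 ^ 6 := by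
  have hτ1 : τ.1 ≤ P.T := by unfold tauNorm at hτ; omega
  have hτ2 : ∑ j, τ.2 j ≤ P.T := by unfold tauNorm at hτ; omega
  have hx : scale P.J₀ 0 * s ≤ P.T * P.S₀ := scale_mul_le P (Nat.zero_le _) (by simpa using hs.le)
  have h𝔅 := P.𝔅_pos
  -- the denominator
  have hD : ((S.Dclear (h := P.R) P.J₀ P.L P.Lθ s τ : ℕ) : ℝ) ≤ P.𝔅 ^ 3 := by
    unfold Dclear
    rw [Nat.cast_mul, Nat.cast_mul]
    have h1 : ((nuBound (scale P.J₀ 0 * s) P.R ^ τ.1 : ℕ) : ℝ) ≤ P.𝔅 ^ 1 := by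
      rw [Nat.cast_pow, pow_one]; exact nuBound_pow_le_𝔅 P hx hτ1
    have h2 : ((S.bθ.natAbs ^ (∑ j, τ.2 j) : ℕ) : ℝ) ≤ P.𝔅 ^ 1 := by rw [pow_one]; exact hy.natAbs_bθ_pow_le hτ2
    have h3 : (((∏ j, (S.α j).den ^ (P.L j * s)) * S.θ.den ^ (P.Lθ * s) : ℕ) : ℝ) ≤ P.𝔅 ^ 1 := by
      rw [pow_one]
      refine hy.den_prod_le (fun j => ?_) ?_
      · calc P.L j * s ≤ P.L j * P.S₀ := Nat.mul_le_mul_left _ hs.le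
          _ ≤ 2 * P.L j * P.S₀ := by nlinarith
      · calc P.Lθ * s ≤ P.Lθ * P.S₀ := Nat.mul_le_mul_left _ hs.le
          _ ≤ 2 * P.Lθ * P.S₀ := by nlinarith
    exact P.mul_le_𝔅_pow (P.mul_le_𝔅_pow h1 h2 (Nat.cast_nonneg _)) h3 (Nat.cast_nonneg _)
  -- the term
  have hQ : |(S.qTerm (h := P.R) P.J₀ 0 u τ s : ℝ)| ≤ P.𝔅 ^ 3 := by
    unfold qTerm; push_cast
    rw [abs_mul, abs_mul]
    have h1 : |(S.qΔ (h := P.R) P.J₀ 0 u τ.1 s : ℝ)| ≤ P.𝔅 ^ 1 := by rw [pow_one]; exact abs_qΔ_le S P u hx hτ1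
    have h2 : |(S.qA u τ.2 : ℝ)| ≤ P.𝔅 ^ 1 := by rw [pow_one]; exact hy.abs_qA_le hu hτ2
    have h3 : |(S.qE u s : ℝ)| ≤ P.𝔅 ^ 1 := by rw [pow_one]; exact hy.abs_qE_le hu hs.le
    exact P.mul_le_𝔅_pow (P.mul_le_𝔅_pow h1 h2 (abs_nonneg _)) h3 (abs_nonneg _)
  rw [abs_mul, Nat.abs_cast]
  exact P.mul_le_𝔅_pow hD hQ (abs_nonneg _)

/-- **`|rHalf| ≤ 𝔅³`** on the box of level `J < J₀`, `|τ| < T`, `s < 2^{J+1} S₀`.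
[cite: CijsouwWaldschmidt1977, §4 Lemma 10 (p. 188)] -/
theorem Hyp.abs_rHalf_le {J : ℕ} (hJ : J < P.J₀) {u : Idx S.d P.R P.Lb}
    (hu : u ∈ S.box (h := P.R) (Lb := P.Lb) P.L P.Lθ J) {τ : Tau S.d} (hτ : tauNorm τ < P.T)
    {s : ℕ} (hs : s < 2 ^ (J + 1) * P.S₀) :
    |(S.rHalf (h := P.R) P.J₀ J u τ s : ℝ)| ≤ P.𝔅 ^ 3 := by
  have hτ1 : τ.1 ≤ P.T := by unfold tauNorm at hτ; omega
  have hτ2 : ∑ j, τ.2 j ≤ P.T := by unfold tauNorm at hτ; omega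
  have hx : scale P.J₀ (J + 1) * s ≤ P.T * P.S₀ := scale_mul_le P hJ hs.le
  unfold rHalf; push_cast
  rw [abs_mul, abs_mul]
  have h1 : |(S.qΔ (h := P.R) P.J₀ (J + 1) u τ.1 s : ℝ)| ≤ P.𝔅 ^ 1 := by rw [pow_one]; exact abs_qΔ_le S P u hx hτ1
  have h2 : |(S.qA u τ.2 : ℝ)| ≤ P.𝔅 ^ 1 := by rw [pow_one]; exact hy.abs_qA_le hu hτ2
  have h3 : |(S.qEh u s : ℝ)| ≤ P.𝔅 ^ 1 := by rw [pow_one]; exact hy.abs_qEh_le hu hs.le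
  exact P.mul_le_𝔅_pow (P.mul_le_𝔅_pow h1 h2 (abs_nonneg _)) h3 (abs_nonneg _)

/-- **`Dhalf ≤ 𝔅³`** for `J < J₀`, `|τ| < T`, `s < 2^{J+1} S₀`. [cite: CijsouwWaldschmidt1977, §4 Lemma 10 (p. 188)] -/
theorem Hyp.Dhalf_le {J : ℕ} (hJ : J < P.J₀) {τ : Tau S.d} (hτ : tauNorm τ < P.T)
    {s : ℕ} (hs : s < 2 ^ (J + 1) * P.S₀) :
    ((S.Dhalf (h := P.R) P.J₀ J P.L P.Lθ s τ : ℕ) : ℝ) ≤ P.𝔅 ^ 3 := by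
  have hτ1 : τ.1 ≤ P.T := by unfold tauNorm at hτ; omega
  have hτ2 : ∑ j, τ.2 j ≤ P.T := by unfold tauNorm at hτ; omega
  have hx : scale P.J₀ (J + 1) * s ≤ P.T * P.S₀ := scale_mul_le P hJ hs.le
  unfold Dhalf
  rw [Nat.cast_mul, Nat.cast_mul]
  have h1 : ((nuBound (scale P.J₀ (J + 1) * s) P.R ^ τ.1 : ℕ) : ℝ) ≤ P.𝔅 ^ 1 := by
    rw [Nat.cast_pow, pow_one]; exact nuBound_pow_le_𝔅 P hx hτ1
  have h2 : ((S.bθ.natAbs ^ (∑ j, τ.2 j) : ℕ) : ℝ) ≤ P.𝔅 ^ 1 := by rw [pow_one]; exact hy.natAbs_bθ_pow_le hτ2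
  have hdiv : ∀ Lq : ℕ, Lq / 2 ^ J * s ≤ 2 * Lq * P.S₀ := by
    intro Lq
    calc Lq / 2 ^ J * s ≤ (Lq / 2 ^ J) * (2 ^ (J + 1) * P.S₀) := Nat.mul_le_mul_left _ hs.le
      _ = 2 * ((Lq / 2 ^ J) * 2 ^ J) * P.S₀ := by rw [pow_succ]; ring
      _ ≤ 2 * Lq * P.S₀ := by
          have := Nat.div_mul_le_self Lq (2 ^ J)
          exact Nat.mul_le_mul_right _ (Nat.mul_le_mul_left _ this)
  have h3 : (((∏ j, (S.α j).den ^ (P.L j / 2 ^ J * s)) * S.θ.den ^ (P.Lθ / 2 ^ J * s) : ℕ) : ℝ) ≤ P.𝔅 ^ 1 := by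
    rw [pow_one]
    exact hy.den_prod_le (fun j => hdiv _) (hdiv _)
  exact P.mul_le_𝔅_pow (P.mul_le_𝔅_pow h1 h2 (Nat.cast_nonneg _)) h3 (Nat.cast_nonneg _)

omit hy in
/-- `L_θ ≤ 𝔘`, `7 L_θ S₀ ≤ 𝔘` (crude). [folklore] -/
theorem seven_LθS₀_le (P : Par S.d) : 7 * ((P.Lθ : ℝ) * P.S₀) ≤ P.Uν ∧ (P.Lθ : ℝ) ≤ P.Uν := by
  have h1 := P.LfS₀_le (Fin.last S.d)
  have hν := P.nu_ge; have hU := P.Uν_pos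
  have hS : (1 : ℝ) ≤ P.S₀ := by have := P.two_le_S₀; exact_mod_cast (show 1 ≤ P.S₀ by omega)
  have h0 : (0 : ℝ) ≤ P.Lf (Fin.last S.d) := Nat.cast_nonneg _
  unfold Par.Lθ
  have h2 : (P.Lf (Fin.last S.d) : ℝ) ≤ P.Lf (Fin.last S.d) * P.S₀ := le_mul_of_one_le_right h0 hS
  have h3 : (P.Lf (Fin.last S.d) : ℝ) * P.S₀ ≤ P.ν * (P.Lf (Fin.last S.d) * P.S₀) :=
    le_mul_of_one_le_left (by positivity) (by linarith)
  constructor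
  · nlinarith
  · linarith

omit hy in
/-- `β 𝔘 ≤ ν² 𝔘` (so that `𝔅 ≤ exp(ν² 𝔘)`). [folklore] -/
theorem βU_le_nu_sq_U (P : Par S.d) : P.β * P.Uν ≤ (P.ν : ℝ) ^ 2 * P.Uν := by
  refine mul_le_mul_of_nonneg_right ?_ P.Uν_pos.le
  unfold Par.β
  have h1 := P.dlog_le; have hν := P.nu_ge; have hl := P.log_nu_nonneg
  have hd := Nat.cast_nonneg (α := ℝ) S.d
  nlinarith

omit hy in
/-- Under the smallness hypothesis `|Λ₀| ≤ exp(−ν² 𝔘)`: `L_θ |Λ₀| ≤ 1` and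
`x = 7 L_θ S₀ |Λ₀| ≤ 1`, `2x ≤ 𝔅 exp(−ν² 𝔘)`. [folklore] -/
theorem smallness (P : Par S.d) (hΛ : |S.Λ₀| ≤ Real.exp (-((P.ν : ℝ) ^ 2 * P.Uν))) :
    (P.Lθ : ℝ) * |S.Λ₀| ≤ 1 ∧ 7 * ((P.Lθ : ℝ) * P.S₀) * |S.Λ₀| ≤ 1 ∧
      2 * (7 * ((P.Lθ : ℝ) * P.S₀) * |S.Λ₀|) ≤ P.𝔅 * Real.exp (-((P.ν : ℝ) ^ 2 * P.Uν)) := by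
  obtain ⟨h7, hL⟩ := seven_LθS₀_le P
  have hU := P.Uν_pos
  have hexp : P.Uν ≤ Real.exp ((P.ν : ℝ) ^ 2 * P.Uν) := by
    have h1 : P.Uν ≤ (P.ν : ℝ) ^ 2 * P.Uν := by
      have : (1 : ℝ) ≤ (P.ν : ℝ) ^ 2 := P.one_le_nu_pow 2
      nlinarith
    exact h1.trans (by linarith [Real.add_one_le_exp ((P.ν : ℝ) ^ 2 * P.Uν)])
  have hprod : Real.exp ((P.ν : ℝ) ^ 2 * P.Uν) * Real.exp (-((P.ν : ℝ) ^ 2 * P.Uν)) = 1 := by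
    rw [← Real.exp_add]; simp
  have hE := Real.exp_pos (-((P.ν : ℝ) ^ 2 * P.Uν))
  have habs := abs_nonneg S.Λ₀
  refine ⟨?_, ?_, ?_⟩
  · calc (P.Lθ : ℝ) * |S.Λ₀| ≤ Real.exp ((P.ν : ℝ) ^ 2 * P.Uν) * Real.exp (-((P.ν : ℝ) ^ 2 * P.Uν)) :=
        mul_le_mul (hL.trans hexp) hΛ habs (Real.exp_pos _).le
      _ = 1 := hprod
  · calc 7 * ((P.Lθ : ℝ) * P.S₀) * |S.Λ₀| ≤ Real.exp ((P.ν : ℝ) ^ 2 * P.Uν) * Real.exp (-((P.ν : ℝ) ^ 2 * P.Uν)) :=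
        mul_le_mul (h7.trans hexp) hΛ habs (Real.exp_pos _).le
      _ = 1 := hprod
  · have h14 := LθS₀_le P
    calc 2 * (7 * ((P.Lθ : ℝ) * P.S₀) * |S.Λ₀|) = (14 * ((P.Lθ : ℝ) * P.S₀)) * |S.Λ₀| := by ring
      _ ≤ P.𝔅 * Real.exp (-((P.ν : ℝ) ^ 2 * P.Uν)) := mul_le_mul h14 hΛ habs P.𝔅_pos.le

omit hy in
/-- **The final numerical inequality**: `3 𝔅¹⁵ e^{−ν𝔘/128} (𝔅¹⁷)^{4^{d+2}} < 1`, from the master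
inequality on `ν`. [folklore] -/
theorem final_numeric (P : Par S.d) :
    3 * P.𝔅 ^ 15 * Real.exp (-(P.ν * P.Uν / 128)) * (P.𝔅 ^ 17) ^ (4 ^ (S.d + 2)) < 1 := by
  rw [← pow_mul, P.𝔅_pow, P.𝔅_pow]
  have h3 : (3 : ℝ) < Real.exp 2 := by
    have := Real.add_one_le_exp (1 : ℝ)
    have h : Real.exp 2 = Real.exp 1 * Real.exp 1 := by rw [← Real.exp_add]; norm_num
    nlinarith [Real.exp_one_gt_two]
  have key : 2 + (15 : ℕ) * (P.β * P.Uν) + -(P.ν * P.Uν / 128) + ((17 * 4 ^ (S.d + 2) : ℕ) : ℝ) * (P.β * P.Uν) < 0 := by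
    push_cast
    set Θ := (4 : ℝ) ^ (S.d + 2) * ((S.d + 2) * (1 + Real.log P.ν)) with hΘ
    have hl := P.log_nu_nonneg
    have hd := Nat.cast_nonneg (α := ℝ) S.d
    have h4 : (16 : ℝ) ≤ 4 ^ (S.d + 2) := by
      calc (16 : ℝ) = 4 ^ 2 := by norm_num
        _ ≤ 4 ^ (S.d + 2) := pow_le_pow_right₀ (by norm_num) (by omega)
    have hΘ32 : 32 ≤ Θ := by
      have : (2 : ℝ) ≤ (S.d + 2) * (1 + Real.log P.ν) := by nlinarith
      rw [hΘ]; nlinarith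
    have hm := P.master'
    have hν : 1000000 * Θ ≤ P.ν := by rw [hΘ]; linarith
    have hβ : P.β = 100 * ((S.d + 2) * (1 + Real.log P.ν)) := by unfold Par.β; ring
    have hβΘ : 4 ^ (S.d + 2) * P.β = 100 * Θ := by rw [hβ, hΘ]; ring
    have hβle : 16 * P.β ≤ 100 * Θ := by
      rw [← hβΘ]; exact mul_le_mul_of_nonneg_right h4 (P.β_pos).le
    have hU := P.Uν_pos
    -- (15 + 17·4^{d+2}) β ≤ 1800 Θ and ν/128 ≥ 7812 Θ
    have h5 : (15 * P.β + 17 * 4 ^ (S.d + 2) * P.β) * P.Uν ≤ 1800 * Θ * P.Uν := by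
      refine mul_le_mul_of_nonneg_right ?_ hU.le; nlinarith
    have h6 : 7812 * Θ * P.Uν ≤ P.ν * P.Uν / 128 := by
      rw [le_div_iff₀ (by norm_num)]; nlinarith
    have h7 : (2 : ℝ) ≤ Θ * P.Uν := by nlinarith [P.four_le_Uν]
    nlinarith
  calc 3 * Real.exp ((15 : ℕ) * (P.β * P.Uν)) * Real.exp (-(P.ν * P.Uν / 128)) *
        Real.exp (((17 * 4 ^ (S.d + 2) : ℕ) : ℝ) * (P.β * P.Uν))
      < Real.exp 2 * Real.exp ((15 : ℕ) * (P.β * P.Uν)) * Real.exp (-(P.ν * P.Uν / 128)) *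
        Real.exp (((17 * 4 ^ (S.d + 2) : ℕ) : ℝ) * (P.β * P.Uν)) := by
        gcongr
    _ = Real.exp (2 + (15 : ℕ) * (P.β * P.Uν) + -(P.ν * P.Uν / 128) + ((17 * 4 ^ (S.d + 2) : ℕ) : ℝ) * (P.β * P.Uν)) := by
        simp only [← Real.exp_add]
    _ < Real.exp 0 := Real.exp_lt_exp.mpr key
    _ = 1 := Real.exp_zero

end Setup

end Literature.NumberTheory.Transcendental.CW77

end

noncomputable section

open Complex Finset Polynomial
open Literature.NumberTheory.Transcendental.Baker1975
open Literature.NumberTheory.Transcendental.Baker1975.Ch3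

namespace Literature.NumberTheory.Transcendental.CW77

namespace Setup

variable {S : Setup} {P : Par S.d} (hy : S.Hyp P)
include hy

attribute [local instance] Matrix.seminormedAddCommGroup

/-- **Step 1 with the chosen parameters**: the invariant at level `0`, with
`P₀ = ⌈#box₀ · 𝔅⁶⌉`. [cite: CijsouwWaldschmidt1977, §4 Step 1 (pp. 185–186)] -/
theorem Hyp.inv_zero :
    ∃ p : Idx S.d P.R P.Lb → ℤ, S.Inv P.J₀ P.L P.Lθ P.S₀ P.T
      ⌈((S.box (h := P.R) (Lb := P.Lb) P.L P.Lθ 0).card : ℝ) * P.𝔅 ^ 6⌉ 0 p :=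
  S.siegel_step (h := P.R) (Lb := P.Lb) P.J₀ P.L P.Lθ P.S₀ P.T (by have := P.two_le_S₀; omega)
    (by have := P.three_le_T; omega) (siegel_count S P) (one_le_pow₀ P.one_le_𝔅)
    fun _s hs _τ hτ _u hu => hy.abs_Dclear_qTerm_le hs hτ hu

omit hy in
/-- `⌈#box₀ · 𝔅⁶⌉ ≤ 𝔅⁸`. [folklore] -/
theorem P₀_le (P : Par S.d) :
    ((⌈((S.box (h := P.R) (Lb := P.Lb) P.L P.Lθ 0).card : ℝ) * P.𝔅 ^ 6⌉ : ℤ) : ℝ) ≤ P.𝔅 ^ 8 := by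
  have h1 := Int.ceil_lt_add_one (((S.box (h := P.R) (Lb := P.Lb) P.L P.Lθ 0).card : ℝ) * P.𝔅 ^ 6)
  have h2 := card_box_le_𝔅 (S := S) P 0
  have hB := P.two_le_𝔅
  have h3 : ((S.box (h := P.R) (Lb := P.Lb) P.L P.Lθ 0).card : ℝ) * P.𝔅 ^ 6 ≤ P.𝔅 ^ 7 := by
    calc ((S.box (h := P.R) (Lb := P.Lb) P.L P.Lθ 0).card : ℝ) * P.𝔅 ^ 6 ≤ P.𝔅 * P.𝔅 ^ 6 :=
          mul_le_mul_of_nonneg_right h2 (by positivity)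
      _ = P.𝔅 ^ 7 := by ring
  have h4 : P.𝔅 ^ 7 + 1 ≤ P.𝔅 ^ 8 := by
    have : (1 : ℝ) ≤ P.𝔅 ^ 7 := one_le_pow₀ P.one_le_𝔅
    nlinarith
  linarith

/-- **Step 2 with the chosen parameters**: from the invariant at level `J < J₀` to level `J + 1`,
under the smallness hypothesis `|Λ₀| ≤ exp(−ν^{2m+5} U)`.
[cite: CijsouwWaldschmidt1977, §4 Step 2 (pp. 187–191)] -/
theorem Hyp.inv_succ (hind : ∀ T : Finset (Fin (S.d + 1)), T.Nonempty → ¬ IsSquare (∏ i ∈ T, S.all i))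
    (hΛ : |S.Λ₀| ≤ Real.exp (-((P.ν : ℝ) ^ 2 * P.Uν))) {J : ℕ} (hJ : J < P.J₀) {P₀ : ℤ}
    (hP₀ : (P₀ : ℝ) ≤ P.𝔅 ^ 8) {p : Idx S.d P.R P.Lb → ℤ} (inv : S.Inv P.J₀ P.L P.Lθ P.S₀ P.T P₀ J p) :
    ∃ p' : Idx S.d P.R P.Lb → ℤ, S.Inv P.J₀ P.L P.Lθ P.S₀ P.T P₀ (J + 1) p' := by
  obtain ⟨hΛ1, hx1, h2x⟩ := smallness P hΛ
  have hB1 := P.one_le_𝔅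
  have hB0 : 0 ≤ P.𝔅 := P.𝔅_pos.le
  have hΩpos := P.Ω_pos
  have hsum0 : 0 ≤ ∑ i, (P.Lf i : ℝ) * P.E i := sum_nonneg fun i _ => by have := P.E_pos i; positivity
  have hSJ : 2 ≤ 2 ^ J * P.S₀ := le_trans P.two_le_S₀ (Nat.le_mul_of_pos_left _ (Nat.pow_pos two_pos))
  refine S.descent_algebra hind hJ inv (S.half_vanish hind hJ inv (P.one_le_T_div_of_le hJ.le) hSJ
    (Nr := P.𝔅) (card_box_le_𝔅 P J) hB1 (Q := P.𝔅) (GA := P.𝔅)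
    (Ψ := (∑ i, (P.Lf i : ℝ) * P.E i + 1) / 2 ^ J) (x := 7 * ((P.Lθ : ℝ) * P.S₀) * |S.Λ₀|)
    (Cl := 1 + (S.d + 1) * P.Ω) (Rmax := P.𝔅 ^ 3) (Dmax := P.𝔅 ^ 3) (Pr := P.𝔅 ^ 8)
    hP₀ (one_le_pow₀ hB1) (fun u _ m hm z hz => norm_Qw_wOf_le S P hJ.le u hm hz) hB1
    (fun u hu τ' hτ' => hy.norm_A_le hu hτ') hB1 (fun u hu => ⟨?_, hy.abs_expo_le hu hΛ1⟩) (by positivity)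
    ?_ hx1 (by positivity) hy.one_add_sum_abs_l_le (fun u hu τ hτ s hs => hy.abs_rHalf_le hJ hu hτ hs)
    (one_le_pow₀ hB1) (fun τ hτ s hs => hy.Dhalf_le hJ hτ hs) ?_)
  · -- `|ψ| ≤ Ψ`
    refine (hy.abs_ψ_le hu).trans ?_
    exact div_le_div_of_nonneg_right (by linarith) (by positivity)
  · -- `hx`
    have h1 : ((P.Lθ / 2 ^ J : ℕ) : ℝ) * ((2 ^ J * P.S₀ : ℕ) : ℝ) ≤ (P.Lθ : ℝ) * P.S₀ := by
      have h2 : (P.Lθ / 2 ^ J) * (2 ^ J * P.S₀) ≤ P.Lθ * P.S₀ := by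
        rw [← Nat.mul_assoc]; exact Nat.mul_le_mul_right _ (Nat.div_mul_le_self _ _)
      exact_mod_cast h2
    have h3 := abs_nonneg S.Λ₀
    calc ((P.Lθ / 2 ^ J : ℕ) : ℝ) * |S.Λ₀| * (7 * ((2 ^ J * P.S₀ : ℕ) : ℝ))
        = 7 * (((P.Lθ / 2 ^ J : ℕ) : ℝ) * ((2 ^ J * P.S₀ : ℕ) : ℝ)) * |S.Λ₀| := by ring
      _ ≤ 7 * ((P.Lθ : ℝ) * P.S₀) * |S.Λ₀| := by
          exact mul_le_mul_of_nonneg_right (mul_le_mul_of_nonneg_left h1 (by norm_num)) h3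
  · -- the final inequality
    dsimp only
    set kpts : ℕ := 2 ^ J * P.S₀ / 2 with hk
    set t : ℕ := P.T / 2 ^ J - P.T / 2 ^ (J + 1) with ht
    set E : ℝ := Real.exp ((∑ i, (P.Lf i : ℝ) * P.E i + 1) / 2 ^ J * (7 * ((2 ^ J * P.S₀ : ℕ) : ℝ))) with hE
    set X2 : ℝ := 2 * (7 * ((P.Lθ : ℝ) * P.S₀) * |S.Λ₀|) with hX2
    set G : ℝ := Real.exp (-(P.ν * P.Uν / 128)) with hG
    set H : ℝ := heightProd S.all with hH
    have hEle : E ≤ P.𝔅 := exp_Ψ_le P J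
    have hX20 : 0 ≤ X2 := by positivity
    have htT : t ≤ P.T := (Nat.sub_le _ _).trans (Nat.div_le_self _ _)
    have hCl := two_Cl_pow_le P htT
    have hkp := two_kpts_pow_le P hJ
    have hktle := P.kt_le J
    have hktge := P.kt_ge hJ
    have hTS := P.TS₀_le
    have hν := P.nu_ge; have hU := P.Uν_pos
    have h28 : (28 * Real.exp 1) ^ (kpts * t) ≤ Real.exp (5 * (P.ν * P.Uν)) := by
      refine (Par.twentyeight_e_pow_le (kpts * t)).trans (Real.exp_le_exp.mpr ?_)
      push_cast; nlinarith
    have h35 : (3 / 5 : ℝ) ^ (kpts * t) ≤ G := by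
      refine (Par.three_fifths_pow_le (kpts * t)).trans (Real.exp_le_exp.mpr ?_)
      push_cast; linarith
    have hHle : H ≤ P.𝔅 := hy.heightProd_le
    have hH1 : 1 ≤ H := one_le_heightProd _
    -- the three terms
    have hBf : P.𝔅 * P.𝔅 ^ 8 * (P.𝔅 * P.𝔅 * E) ≤ P.𝔅 ^ 12 := by
      calc P.𝔅 * P.𝔅 ^ 8 * (P.𝔅 * P.𝔅 * E) = P.𝔅 ^ 11 * E := by ring
        _ ≤ P.𝔅 ^ 11 * P.𝔅 := mul_le_mul_of_nonneg_left hEle (by positivity)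
        _ = P.𝔅 ^ 12 := by ring
    have hBf0 : 0 ≤ P.𝔅 * P.𝔅 ^ 8 * (P.𝔅 * P.𝔅 * E) := by positivity
    have hε : P.𝔅 * P.𝔅 ^ 8 * (P.𝔅 * P.𝔅 * E) * X2 ≤ P.𝔅 ^ 13 * Real.exp (-((P.ν : ℝ) ^ 2 * P.Uν)) := by
      calc P.𝔅 * P.𝔅 ^ 8 * (P.𝔅 * P.𝔅 * E) * X2 ≤ P.𝔅 ^ 12 * (P.𝔅 * Real.exp (-((P.ν : ℝ) ^ 2 * P.Uν))) :=
            mul_le_mul hBf h2x hX20 (by positivity)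
        _ = P.𝔅 ^ 13 * Real.exp (-((P.ν : ℝ) ^ 2 * P.Uν)) := by ring
    have hG1 : Real.exp (5 * (P.ν * P.Uν)) * Real.exp (-((P.ν : ℝ) ^ 2 * P.Uν)) ≤ G := by
      rw [hG, ← Real.exp_add, Real.exp_le_exp]
      nlinarith
    have hG2 : Real.exp (-((P.ν : ℝ) ^ 2 * P.Uν)) ≤ G := by
      rw [hG, Real.exp_le_exp]; nlinarith
    have hG0 : 0 ≤ G := (Real.exp_pos _).le
    have h12 : P.𝔅 ^ 12 ≤ P.𝔅 ^ 15 := pow_le_pow_right₀ hB1 (by norm_num)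
    have h13 : P.𝔅 ^ 13 ≤ P.𝔅 ^ 15 := pow_le_pow_right₀ hB1 (by norm_num)
    have hterm1 : 2 * (kpts : ℝ) ^ (t + 1) * t * (28 * Real.exp 1) ^ (kpts * t) *
        ((2 * (1 + (S.d + 1) * P.Ω)) ^ t * (P.𝔅 * P.𝔅 ^ 8 * (P.𝔅 * P.𝔅 * E) * X2)) ≤ P.𝔅 ^ 15 * G := by
      calc 2 * (kpts : ℝ) ^ (t + 1) * t * (28 * Real.exp 1) ^ (kpts * t) *
            ((2 * (1 + (S.d + 1) * P.Ω)) ^ t * (P.𝔅 * P.𝔅 ^ 8 * (P.𝔅 * P.𝔅 * E) * X2))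
          ≤ (P.𝔅 * Real.exp (5 * (P.ν * P.Uν))) * (P.𝔅 * (P.𝔅 ^ 13 * Real.exp (-((P.ν : ℝ) ^ 2 * P.Uν)))) :=
            mul_le_mul (mul_le_mul hkp h28 (by positivity) hB0) (mul_le_mul hCl hε (by positivity) hB0)
              (by positivity) (by positivity)
        _ = P.𝔅 ^ 15 * (Real.exp (5 * (P.ν * P.Uν)) * Real.exp (-((P.ν : ℝ) ^ 2 * P.Uν))) := by ring
        _ ≤ P.𝔅 ^ 15 * G := mul_le_mul_of_nonneg_left hG1 (by positivity)
    have hterm2 : P.𝔅 * P.𝔅 ^ 8 * (P.𝔅 * P.𝔅 * E) * (3 / 5 : ℝ) ^ (kpts * t) ≤ P.𝔅 ^ 15 * G :=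
      (mul_le_mul hBf h35 (by positivity) (by positivity)).trans (mul_le_mul_of_nonneg_right h12 hG0)
    have hterm3 : P.𝔅 * P.𝔅 ^ 8 * (P.𝔅 * P.𝔅 * E) * X2 ≤ P.𝔅 ^ 15 * G :=
      hε.trans (mul_le_mul h13 hG2 (Real.exp_pos _).le (by positivity))
    -- the right-hand side
    have hbase : 2 * P.𝔅 ^ 3 * (P.𝔅 * P.𝔅 ^ 8 * P.𝔅 ^ 3) * H ≤ P.𝔅 ^ 17 := by
      have hB2 := P.two_le_𝔅
      calc 2 * P.𝔅 ^ 3 * (P.𝔅 * P.𝔅 ^ 8 * P.𝔅 ^ 3) * H = P.𝔅 ^ 15 * (2 * H) := by ring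
        _ ≤ P.𝔅 ^ 15 * (P.𝔅 * P.𝔅) := by
            refine mul_le_mul_of_nonneg_left ?_ (by positivity)
            exact mul_le_mul hB2 hHle (by linarith) hB0
        _ = P.𝔅 ^ 17 := by ring
    have hbase0 : 0 < 2 * P.𝔅 ^ 3 * (P.𝔅 * P.𝔅 ^ 8 * P.𝔅 ^ 3) * H := by positivity
    have hrhs : 1 / (P.𝔅 ^ 17) ^ (4 ^ (S.d + 1 + 1)) ≤ 1 / (2 * P.𝔅 ^ 3 * (P.𝔅 * P.𝔅 ^ 8 * P.𝔅 ^ 3) * H) ^ (4 ^ (S.d + 1 + 1)) :=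
      one_div_le_one_div_of_le (pow_pos hbase0 _) (pow_le_pow_left₀ hbase0.le hbase _)
    have hfin : 3 * (P.𝔅 ^ 15 * G) < 1 / (P.𝔅 ^ 17) ^ (4 ^ (S.d + 1 + 1)) := by
      rw [lt_div_iff₀ (by positivity)]
      have := final_numeric (S := S) P
      have e : S.d + 1 + 1 = S.d + 2 := rfl
      rw [e, hG]; linarith
    -- combine (the `x` of `ε₉` appears as `2 * x`)
    have hX2' : P.𝔅 * P.𝔅 ^ 8 * (P.𝔅 * P.𝔅 * E) * (2 * (7 * ((P.Lθ : ℝ) * P.S₀) * |S.Λ₀|)) =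
        P.𝔅 * P.𝔅 ^ 8 * (P.𝔅 * P.𝔅 * E) * X2 := by rw [hX2]
    rw [hX2']
    linarith

/-- **The invariant at all levels `J ≤ J₀`** (induction on `J`). [cite: CijsouwWaldschmidt1977, §4 Step 2 (p. 191)] -/
theorem Hyp.inv_all (hind : ∀ T : Finset (Fin (S.d + 1)), T.Nonempty → ¬ IsSquare (∏ i ∈ T, S.all i))
    (hΛ : |S.Λ₀| ≤ Real.exp (-((P.ν : ℝ) ^ 2 * P.Uν))) {J : ℕ} (hJ : J ≤ P.J₀) :
    ∃ p : Idx S.d P.R P.Lb → ℤ, S.Inv P.J₀ P.L P.Lθ P.S₀ P.T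
      ⌈((S.box (h := P.R) (Lb := P.Lb) P.L P.Lθ 0).card : ℝ) * P.𝔅 ^ 6⌉ J p := by
  induction J with
  | zero => exact hy.inv_zero
  | succ J ih =>
    obtain ⟨p, inv⟩ := ih (by omega)
    exact hy.inv_succ hind hΛ (by omega) (P₀_le P) inv

/-- **Proposition 1 of Cijsouw–Waldschmidt over `ℚ` (`p = 2`, `β₀ = 0`), core form**: if the square
classes of `α₁, …, α_d, θ` are independent, the heights are bounded by `exp Eᵢ` and the coefficients by
`B`, then `|β₁ log α₁ + ⋯ + β_d log α_d − log θ| > exp(−ν^{2m+5} U)`, `U = Ω log Ω (log B + log Ω)`.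
[cite: CijsouwWaldschmidt1977, Proposition 1 and §4 (pp. 182–191)] -/
theorem Hyp.main (hind : ∀ T : Finset (Fin (S.d + 1)), T.Nonempty → ¬ IsSquare (∏ i ∈ T, S.all i)) :
    Real.exp (-((P.ν : ℝ) ^ 2 * P.Uν)) < |S.Λ₀| := by
  by_contra hcon
  have hΛ : |S.Λ₀| ≤ Real.exp (-((P.ν : ℝ) ^ 2 * P.Uν)) := not_lt.mp hcon
  obtain ⟨p, inv⟩ := hy.inv_all hind hΛ le_rfl
  exact S.endgame inv (fun j => P.Lf_lt_two_pow _) (P.Lf_lt_two_pow _) P.one_le_T_div P.RLb_le_count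

end Setup

end Literature.NumberTheory.Transcendental.CW77

end

noncomputable section

open Complex Finset Polynomial Height
open Literature.NumberTheory.Transcendental.Baker1975
open Literature.NumberTheory.Transcendental.Baker1975.Ch3

namespace Literature.NumberTheory.Transcendental.CW77

/-! ### A concrete admissible `ν` -/

/-- A concrete integer satisfying the master inequality: `ν(d) = (10⁶ · 4^{d+2} · (d+2))²`. [folklore] -/
def Par.nuOf (d : ℕ) : ℕ := (1000000 * 4 ^ (d + 2) * (d + 2)) ^ 2

/-- `ν(d)` satisfies the master inequality `10⁶ 4^{d+2} (d+2) (1 + log ν) ≤ ν`. [folklore] -/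
theorem Par.master_nuOf (d : ℕ) :
    1000000 * 4 ^ (d + 2) * (d + 2) * (1 + Real.log (Par.nuOf d : ℕ)) ≤ ((Par.nuOf d : ℕ) : ℝ) := by
  set K : ℝ := 1000000 * 4 ^ (d + 2) * (d + 2) with hK
  have hcast : ((Par.nuOf d : ℕ) : ℝ) = K ^ 2 := by unfold Par.nuOf; push_cast; rw [hK]
  rw [hcast]
  have hK25 : (25 : ℝ) ≤ K := by
    have h4 : (1 : ℝ) ≤ 4 ^ (d + 2) := one_le_pow₀ (by norm_num)
    have hd : (2 : ℝ) ≤ d + 2 := by have := Nat.cast_nonneg (α := ℝ) d; linarith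
    rw [hK]; nlinarith
  have hK0 : 0 < K := by linarith
  set r := Real.sqrt K with hr
  have hrr : r * r = K := Real.mul_self_sqrt hK0.le
  have hr5 : 5 ≤ r := by
    rw [hr, show (5 : ℝ) = Real.sqrt 25 by rw [show (25 : ℝ) = 5 ^ 2 by norm_num, Real.sqrt_sq (by norm_num)]]
    exact Real.sqrt_le_sqrt hK25
  have hlogK : Real.log K ≤ 2 * r := by
    have h1 : Real.log K = 2 * Real.log r := by
      rw [hr, Real.log_sqrt hK0.le]; ring
    have h2 : Real.log r ≤ r - 1 := Real.log_le_sub_one_of_pos (by linarith)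
    linarith
  have hlog : Real.log (K ^ 2) = 2 * Real.log K := by rw [Real.log_pow]; norm_num
  rw [hlog]
  -- `K (1 + 2 log K) ≤ K (1 + 4 r) ≤ K · K`
  have h3 : 1 + 4 * r ≤ K := by nlinarith
  have h4 : 1 + 2 * Real.log K ≤ K := by linarith
  calc K * (1 + 2 * Real.log K) ≤ K * K := mul_le_mul_of_nonneg_left h4 hK0.le
    _ = K ^ 2 := (sq K).symm

/-! ### The converse of the Kummer computation: degree `2ⁿ` forces independent square classes -/

/-- **If `[ℚ(√α₀,…,√α_{n−1}) : ℚ] = 2ⁿ` (`αⱼ ≥ 0`) then no non-empty sub-product of the `αⱼ` is a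
square in `ℚ`** (the square-root monomials span the field, so they are then linearly independent,
and a square sub-product would be a linear relation between two of them). [folklore] -/
theorem not_isSquare_prod_of_finrank_eq {n : ℕ} (α : Fin n → ℚ) (hα : ∀ j, 0 ≤ α j)
    (hfin : Module.finrank ℚ ↥(IntermediateField.adjoin ℚ (Set.range fun j => Real.sqrt (α j : ℝ))) = 2 ^ n) :
    ∀ T : Finset (Fin n), T.Nonempty → ¬ IsSquare (∏ j ∈ T, α j) := by
  classical
  set v : Finset (Fin n) → ℝ := fun S => ∏ j ∈ S, Real.sqrt (α j : ℝ) with hv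
  set E : IntermediateField ℚ ℝ :=
    IntermediateField.adjoin ℚ (Set.range fun j => Real.sqrt (α j : ℝ)) with hE
  set V : Submodule ℚ ℝ := Submodule.span ℚ (Set.range v) with hV
  -- `V` is closed under multiplication and contains `1`
  have hVmul : ∀ x y, x ∈ V → y ∈ V → x * y ∈ V := by
    intro x y hx hy
    have hxy : x * y ∈ V * V := Submodule.mul_mem_mul hx hy
    rw [hV, Submodule.span_mul_span] at hxy
    refine (Submodule.span_le.mpr ?_) hxy
    rintro _ ⟨a, ⟨S, rfl⟩, b, ⟨T, rfl⟩, rfl⟩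
    show v S * v T ∈ Submodule.span ℚ (Set.range v)
    have hprod : v S * v T = (∏ j ∈ S ∩ T, α j : ℚ) • v (symmDiff S T) := by
      rw [Algebra.smul_def]
      exact Literature.Barriers.ABC.prod_sqrt_mul_prod_sqrt α hα S T
    rw [hprod]
    exact Submodule.smul_mem _ _ (Submodule.subset_span ⟨symmDiff S T, rfl⟩)
  have h1 : (1 : ℝ) ∈ V := Submodule.subset_span ⟨∅, by simp [hv]⟩
  set A : Subalgebra ℚ ℝ := V.toSubalgebra h1 hVmul with hA
  have halg : ∀ x ∈ Set.range (fun j => Real.sqrt (α j : ℝ)), IsAlgebraic ℚ x := by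
    rintro _ ⟨j, rfl⟩
    have hint : IsIntegral ℚ (Real.sqrt (α j : ℝ) ^ 2) := by
      have : Real.sqrt (α j : ℝ) ^ 2 = algebraMap ℚ ℝ (α j) := by
        rw [sq, Real.mul_self_sqrt (by exact_mod_cast hα j)]; rfl
      rw [this]; exact isIntegral_algebraMap
    exact (hint.of_pow two_pos).isAlgebraic
  have hEA : E.toSubalgebra ≤ A := by
    rw [hE, IntermediateField.adjoin_toSubalgebra_of_isAlgebraic halg]
    refine Algebra.adjoin_le ?_
    rintro _ ⟨j, rfl⟩
    show Real.sqrt (α j : ℝ) ∈ V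
    exact Submodule.subset_span ⟨{j}, by simp [hv]⟩
  have hVE : V = Subalgebra.toSubmodule E.toSubalgebra := by
    apply le_antisymm
    · rw [hV, Submodule.span_le]
      rintro _ ⟨S, rfl⟩
      show v S ∈ E
      exact prod_mem fun j _ => IntermediateField.subset_adjoin ℚ _ ⟨j, rfl⟩
    · intro x hx; exact hEA hx
  have hli : LinearIndependent ℚ v := by
    rw [linearIndependent_iff_card_eq_finrank_span, Fintype.card_finset, Fintype.card_fin]
    show 2 ^ n = Module.finrank ℚ ↥(Submodule.span ℚ (Set.range v))
    rw [← hV, hVE, Subalgebra.finrank_toSubmodule]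
    exact hfin.symm
  -- a square sub-product gives a linear relation
  rintro T hT ⟨q, hq⟩
  have hvT2 : v T * v T = ((∏ j ∈ T, α j : ℚ) : ℝ) := by
    have := Literature.Barriers.ABC.prod_sqrt_mul_prod_sqrt α hα T T
    rw [Finset.inter_self, symmDiff_self] at this
    rw [this]
    show ((∏ j ∈ T, α j : ℚ) : ℝ) * v ⊥ = _
    have : v ⊥ = 1 := by simp [hv]
    rw [this, mul_one]
  have h0 : 0 ≤ v T := prod_nonneg fun j _ => Real.sqrt_nonneg _
  have hvT : v T = |(q : ℝ)| := by
    have : v T * v T = |(q : ℝ)| * |(q : ℝ)| := by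
      rw [hvT2, hq, abs_mul_abs_self]; push_cast; ring
    exact (mul_self_inj h0 (abs_nonneg _)).mp this
  have hne : T ≠ ∅ := hT.ne_empty
  have hempty : v ∅ = 1 := by simp [hv]
  have hrel := linearIndependent_iff'.mp hli {T, ∅} (fun S => if S = T then (1 : ℚ) else -|q|) (by
    rw [Finset.sum_pair hne]
    simp only [if_true, if_neg (Ne.symm hne)]
    rw [hvT, hempty, one_smul, Rat.smul_def]
    push_cast; ring) T (Finset.mem_insert_self _ _)
  simp at hrel

/-! ### The archimedean lower bound in the shape `hW₃` of `BakerMethodBoundsKummerArchSymmProofs` -/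

/-- The constant of the archimedean bound as a function of `d = n` (`n + 1` logarithms):
`ν(n)^{2n+7} e^{n+1} · 2.5 (n+1) · (2.5 n + 4)`. [cite: CijsouwWaldschmidt1977, Proposition 1 (C = ν^{2n+5})] -/
def archConst (n : ℕ) : ℝ :=
  ((Par.nuOf n : ℕ) : ℝ) ^ (2 * n + 7) * Real.exp 1 ^ (n + 1) * (5 / 2 * (n + 1)) * (5 / 2 * n + 4)

/-- The constant as a function of the number `m = n + 1` of logarithms. [folklore] -/
def archCw (m : ℕ) : ℝ := archConst (m - 1)

/-- `0 ≤ archCw m`. [folklore] -/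
theorem archCw_nonneg (m : ℕ) : 0 ≤ archCw m := by
  unfold archCw archConst; positivity

/-- **Cijsouw–Waldschmidt's Proposition 1 over `ℚ` with `p = 2`, in the symmetric shape `hW₃`** used
by `Literature.Barriers.ABC.BakerMethodBounds_of_yu_kummerArchBound₃`: for positive rationals
`α₀, …, αₙ ≠ 1` with `[ℚ(√α₀, …, √αₙ) : ℚ] = 2^{n+1}` (the Kummer condition), sizes `1 ≤ V₀ ≤ ⋯ ≤ Vₙ`
with `max(h(αⱼ), |log αⱼ|) ≤ Vⱼ`, integers `bⱼ` with `h(bⱼ) ≤ W` (`W > 0`) and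
`Λ = ∑ bⱼ log αⱼ ≠ 0`:
`|Λ| > exp(−C(n+1) · V₀⋯Vₙ · (W + log(2Vₙ)) · log(2Vₙ) / (log 2)^{n+2})`.
[cite: CijsouwWaldschmidt1977, Theorem 1 and Proposition 1 (pp. 174, 182–191)] -/
theorem cw77_prop1_rat_hW₃ :
    ∀ (n : ℕ) (α : Fin (n + 1) → ℚ) (b : Fin (n + 1) → ℤ) (V : Fin (n + 1) → ℝ) (W : ℝ),
      (∀ j, 0 < α j ∧ α j ≠ 1) →
      Module.finrank ℚ ↥(IntermediateField.adjoin ℚ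
          (Set.range fun j => Real.sqrt (α j : ℝ))) = 2 ^ (n + 1) →
      Monotone V → 1 ≤ V 0 →
      (∀ j, max (logHeight₁ (α j)) |Real.log (α j : ℝ)| ≤ V j) →
      0 < W → (∀ j, logHeight₁ (b j : ℚ) ≤ W) →
      ∑ j, (b j : ℝ) * Real.log (α j : ℝ) ≠ 0 →
      Real.exp (-(archCw (n + 1) * (∏ j, V j) * (W + Real.log (2 * V (Fin.last n))) *
          Real.log (2 * V (Fin.last n)) / Real.log 2 ^ (n + 2))) <
        |∑ j, (b j : ℝ) * Real.log (α j : ℝ)| := by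
  intro n α b V W hα hfin hVmono hV0 hVj hW hWb hΛne
  classical
  have hV1 : ∀ j, 1 ≤ V j := fun j => hV0.trans (hVmono (Fin.zero_le j))
  have hVlast : ∀ j, V j ≤ V (Fin.last n) := fun j => hVmono (Fin.le_last j)
  -- a non-zero coefficient
  obtain ⟨j₀, hj₀⟩ : ∃ j, b j ≠ 0 := by
    by_contra h
    apply hΛne
    refine sum_eq_zero fun j _ => ?_
    have : b j = 0 := by
      by_contra hb; exact h ⟨j, hb⟩
    rw [this]; simp
  -- the data
  set S : Setup := ⟨n, fun j => α (j₀.succAbove j), α j₀, fun j => (hα _).1, (hα _).1,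
    fun j => b (j₀.succAbove j), b j₀, hj₀⟩ with hSdef
  set σ : Fin (n + 1) → Fin (n + 1) := fun i => Fin.lastCases j₀ (fun j => j₀.succAbove j) i with hσ
  have hσc : ∀ j : Fin n, σ (Fin.castSucc j) = j₀.succAbove j := fun j => by
    simp only [hσ, Fin.lastCases_castSucc]
  have hσl : σ (Fin.last n) = j₀ := by simp only [hσ, Fin.lastCases_last]
  have hσinj : Function.Injective σ := by
    intro i i' h
    induction i using Fin.lastCases with
    | last =>
      induction i' using Fin.lastCases with
      | last => rfl
      | cast j' => rw [hσl, hσc] at h; exact absurd h.symm (Fin.succAbove_ne j₀ j')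
    | cast j =>
      induction i' using Fin.lastCases with
      | last => rw [hσl, hσc] at h; exact absurd h (Fin.succAbove_ne j₀ j)
      | cast j' => rw [hσc, hσc] at h; rw [Fin.succAbove_right_injective h]
  have hσbij : Function.Bijective σ := Finite.injective_iff_bijective.mp hσinj
  have hall : ∀ i, S.all i = α (σ i) := by
    intro i
    induction i using Fin.lastCases with
    | last => rw [hσl]; unfold Setup.all; rw [Fin.snoc_last]
    | cast j => rw [hσc]; unfold Setup.all; rw [Fin.snoc_castSucc]
  -- the parameters
  have hmaxW : 1 ≤ max W 1 := le_max_right _ _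
  set P : Par S.d := ⟨fun i => Real.exp 1 * V (σ i), Real.exp (max W 1), Par.nuOf n,
    fun i => le_mul_of_one_le_right (Real.exp_pos 1).le (hV1 _),
    Real.exp_le_exp.mpr hmaxW, Par.master_nuOf n⟩ with hPdef
  -- the hypotheses `Hyp`
  have hy : S.Hyp P := by
    refine ⟨fun i => ?_, fun j => ?_, ?_⟩
    · show Real.log (hgt (S.all i)) ≤ Real.exp 1 * V (σ i)
      rw [hall i]
      have h1 : Real.log (hgt (α (σ i))) = logHeight₁ (α (σ i)) := by
        rw [Rat.logHeight₁_eq_log_max]; rfl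
      rw [h1]
      calc logHeight₁ (α (σ i)) ≤ V (σ i) := (le_max_left _ _).trans (hVj _)
        _ ≤ Real.exp 1 * V (σ i) := le_mul_of_one_le_left (by linarith [hV1 (σ i)]) (by linarith [Real.exp_one_gt_two])
    · show |((b (j₀.succAbove j) : ℤ) : ℝ)| ≤ Real.exp (max W 1)
      have h1 := hWb (j₀.succAbove j)
      rw [Literature.Barriers.ABC.logHeight₁_intCast_eq, Real.log_le_iff_le_exp (by positivity)] at h1
      exact (le_max_left _ _).trans (h1.trans (Real.exp_le_exp.mpr (le_max_left _ _)))
    · show |((b j₀ : ℤ) : ℝ)| ≤ Real.exp (max W 1)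
      have h1 := hWb j₀
      rw [Literature.Barriers.ABC.logHeight₁_intCast_eq, Real.log_le_iff_le_exp (by positivity)] at h1
      exact (le_max_left _ _).trans (h1.trans (Real.exp_le_exp.mpr (le_max_left _ _)))
  -- the Kummer condition for `S.all`
  have hindα := not_isSquare_prod_of_finrank_eq α (fun j => (hα j).1.le) hfin
  have hind : ∀ T : Finset (Fin (S.d + 1)), T.Nonempty → ¬ IsSquare (∏ i ∈ T, S.all i) := by
    intro T hT hsq
    refine hindα (T.map ⟨σ, hσinj⟩) (by simpa using hT) ?_
    rw [Finset.prod_map]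
    simpa [hall] using hsq
  -- the main inequality
  have hmain := hy.main hind
  have hΛ : S.Λ = ∑ j, (b j : ℝ) * Real.log (α j : ℝ) := by
    unfold Setup.Λ Setup.l Setup.lθ
    rw [Fin.sum_univ_succAbove _ j₀]
    simp only [hSdef]
    ring
  have habs : |S.Λ₀| ≤ |∑ j, (b j : ℝ) * Real.log (α j : ℝ)| := by rw [← hΛ]; exact S.abs_Λ₀_le
  refine lt_of_le_of_lt ?_ (hmain.trans_le habs)
  rw [Real.exp_le_exp, neg_le_neg_iff]
  -- the comparison of the exponents
  set L₂ := Real.log (2 * V (Fin.last n)) with hL₂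
  set PV := ∏ j, V j with hPV
  have hL₂ge : Real.log 2 ≤ L₂ := by
    rw [hL₂]; exact Real.log_le_log two_pos (by linarith [hV1 (Fin.last n)])
  have hl2 : (0.69 : ℝ) ≤ Real.log 2 := by linarith [Real.log_two_gt_d9]
  have hL₂0 : 0 < L₂ := by linarith
  have hlogV : 0 ≤ Real.log (V (Fin.last n)) := Real.log_nonneg (hV1 _)
  have hL₂eq : L₂ = Real.log 2 + Real.log (V (Fin.last n)) := by
    rw [hL₂, Real.log_mul two_ne_zero (by linarith [hV1 (Fin.last n)])]
  have hPV1 : 1 ≤ PV := by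
    rw [hPV]
    calc (1 : ℝ) = ∏ _j : Fin (n + 1), (1 : ℝ) := by simp
      _ ≤ ∏ j, V j := prod_le_prod (fun _ _ => zero_le_one) fun j _ => hV1 j
  -- `Ω = e^{n+1} PV`
  have hΩ : P.Ω = Real.exp 1 ^ (n + 1) * PV := by
    show ∏ i, Real.exp 1 * V (σ i) = _
    rw [prod_mul_distrib, prod_const, card_univ, Fintype.card_fin, hPV]
    congr 1
    exact Fintype.prod_bijective σ hσbij _ _ fun i => rfl
  -- `log Ω ≤ (n+1)(1 + log V_last) ≤ 2.5 (n+1) L₂`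
  have hlΩ : P.lΩ ≤ 5 / 2 * (n + 1) * L₂ := by
    have h1 : P.Ω ≤ (Real.exp 1 * V (Fin.last n)) ^ (n + 1) := by
      show ∏ i, Real.exp 1 * V (σ i) ≤ _
      calc ∏ i, Real.exp 1 * V (σ i) ≤ ∏ _i : Fin (n + 1), Real.exp 1 * V (Fin.last n) :=
            prod_le_prod (fun i _ => by have := hV1 (σ i); positivity)
              fun i _ => mul_le_mul_of_nonneg_left (hVlast _) (Real.exp_pos 1).le
        _ = (Real.exp 1 * V (Fin.last n)) ^ (n + 1) := by simp
    have h2 : P.lΩ ≤ (n + 1) * (1 + Real.log (V (Fin.last n))) := by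
      show Real.log P.Ω ≤ _
      calc Real.log P.Ω ≤ Real.log ((Real.exp 1 * V (Fin.last n)) ^ (n + 1)) := Real.log_le_log P.Ω_pos h1
        _ = (n + 1) * (1 + Real.log (V (Fin.last n))) := by
            rw [Real.log_pow, Real.log_mul (Real.exp_pos 1).ne' (by linarith [hV1 (Fin.last n)]), Real.log_exp]
            push_cast; ring
    have h3 : 1 + Real.log (V (Fin.last n)) ≤ 5 / 2 * L₂ := by rw [hL₂eq]; nlinarith
    have hn : (0 : ℝ) ≤ n + 1 := by positivity
    calc P.lΩ ≤ (n + 1) * (1 + Real.log (V (Fin.last n))) := h2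
      _ ≤ (n + 1) * (5 / 2 * L₂) := mul_le_mul_of_nonneg_left h3 hn
      _ = 5 / 2 * (n + 1) * L₂ := by ring
  -- `log B + log Ω ≤ (2.5 n + 4)(W + L₂)`
  have hW₀ : P.W₀ ≤ (5 / 2 * n + 4) * (W + L₂) := by
    show Real.log (Real.exp (max W 1)) + P.lΩ ≤ _
    rw [Real.log_exp]
    have h1 : max W 1 ≤ W + 1 := max_le (by linarith) (by linarith)
    have h2 : (1 : ℝ) ≤ 3 / 2 * L₂ := by nlinarith
    have hn : (0 : ℝ) ≤ n := Nat.cast_nonneg n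
    nlinarith
  -- assembling
  have hν0 : (0 : ℝ) ≤ (P.ν : ℝ) := Nat.cast_nonneg _
  have hU : (P.ν : ℝ) ^ 2 * P.Uν =
      ((Par.nuOf n : ℕ) : ℝ) ^ (2 * n + 7) * (Real.exp 1 ^ (n + 1) * PV) * P.lΩ * P.W₀ := by
    show (P.ν : ℝ) ^ 2 * ((P.ν : ℝ) ^ (2 * S.d + 5) * (P.Ω * P.lΩ * P.W₀)) = _
    rw [hΩ]
    show ((Par.nuOf n : ℕ) : ℝ) ^ 2 * (((Par.nuOf n : ℕ) : ℝ) ^ (2 * n + 5) * (Real.exp 1 ^ (n + 1) * PV * P.lΩ * P.W₀)) = _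
    ring
  rw [hU]
  have hlΩ0 : 0 ≤ P.lΩ := P.lΩ_pos.le
  have hW₀0 : 0 ≤ P.W₀ := P.W₀_pos.le
  have hC : archCw (n + 1) = ((Par.nuOf n : ℕ) : ℝ) ^ (2 * n + 7) * Real.exp 1 ^ (n + 1) * (5 / 2 * (n + 1)) * (5 / 2 * n + 4) := by
    unfold archCw archConst; simp
  have hbig : ((Par.nuOf n : ℕ) : ℝ) ^ (2 * n + 7) * (Real.exp 1 ^ (n + 1) * PV) * P.lΩ * P.W₀ ≤
      archCw (n + 1) * PV * (W + L₂) * L₂ := by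
    rw [hC]
    have hA : 0 ≤ ((Par.nuOf n : ℕ) : ℝ) ^ (2 * n + 7) * (Real.exp 1 ^ (n + 1) * PV) := by positivity
    calc ((Par.nuOf n : ℕ) : ℝ) ^ (2 * n + 7) * (Real.exp 1 ^ (n + 1) * PV) * P.lΩ * P.W₀
        ≤ ((Par.nuOf n : ℕ) : ℝ) ^ (2 * n + 7) * (Real.exp 1 ^ (n + 1) * PV) * (5 / 2 * (n + 1) * L₂) * ((5 / 2 * n + 4) * (W + L₂)) := by
          refine mul_le_mul (mul_le_mul_of_nonneg_left hlΩ hA) hW₀ hW₀0 (by positivity)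
      _ = ((Par.nuOf n : ℕ) : ℝ) ^ (2 * n + 7) * Real.exp 1 ^ (n + 1) * (5 / 2 * (n + 1)) * (5 / 2 * n + 4) * PV * (W + L₂) * L₂ := by ring
  refine hbig.trans ?_
  -- dividing by `(log 2)^{n+2} ≤ 1` only increases
  have hden : 0 < Real.log 2 ^ (n + 2) := pow_pos (by linarith) _
  have hden1 : Real.log 2 ^ (n + 2) ≤ 1 := pow_le_one₀ (by linarith) (by linarith [Real.log_two_lt_d9])
  rw [le_div_iff₀ hden]
  have hnum : 0 ≤ archCw (n + 1) * PV * (W + L₂) * L₂ := by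
    have := archCw_nonneg (n + 1); positivity
  nlinarith

end Literature.NumberTheory.Transcendental.CW77

end
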